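import Literature.Combinatorics.Optimization.PolytopePsdRankLowerBound
import Literature.Combinatorics.Optimization.PsdFactorNorms
import Literature.LinearAlgebra.Matrix.RankMinors
import HarnessLib

/-!
# Psd-minimal polytopes: rank-one factors, `n + 2` vertices, and the polygons of psd rank three
# (Gouveia–Robinson–Thomas 2013, Prop. 2.6, Thm. 4.3, Thm. 4.7, Ex. 3.6) — all PROVED

Source. J. Gouveia, R. Z. Robinson, R. R. Thomas, *Polytopes of minimum positive semidefinite rank*,
Discrete Comput. Geom. 50 (2013) 679–699 = arXiv:1205.5306 [GouveiaRobinsonThomas2013] (held text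
`paper:arxiv-1205.5306`; `pNN` = held-text chunk). The survey H. Fawzi, J. Gouveia, P. A. Parrilo,
R. Z. Robinson, R. R. Thomas, *Positive semidefinite rank*, Math. Program. 153 (2015) [FawziEtAl2015]
§5.2 (held text `paper:arxiv-1407.4095` p15) cites it for Corollary 5.9 (`rank_psd S_P ≥ dim P + 1`,
DISCHARGED in `PolytopePsdRankLowerBound.lean`) and for the sentence "characterized those polytopes
that achieve this lower bound in `ℝ²` and `ℝ³`". This file proves the results of GRT that the tree's
`PolytopePsdRankLowerBound.lean` lists as "NOT here" — the planar characterisation in full: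

* **Proposition 2.6, second statement** (p05: "the factor associated to the last column of `M'` in any
  `S^{k+1}_+`-factorization of `M'` has rank one"), through its mechanism in reusable form:
  `hasPsdFactorization_trace_of_orthogonal` (psd `A_i` all trace-orthogonal to one psd `C` ⇒
  `(Tr A_iB_j)` factors in size `K − rank C`, compression to `ker C`), `rank_colFactor_add_le` /
  `rank_rowFactor_add_le` (`rank B_c + rank_psd(rows vanishing at c) ≤ K`), and the verbatim bordered
  form `GouveiaRobinsonThomas2013_prop26_rankOne`. (The first statement of Prop. 2.6 is the tree's
  `HasPsdFactorization.exists_lt_of_bordered`.) Its **Example 2.7** (p06: a positive diagonal `n × n`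
  matrix has psd rank `n` — the tree's FGPRT Ex. 2.11 `hasPsdFactorization_diagonal_iff` — "and each
  factor in an `S^n_+`-factorization of such a diagonal matrix must have rank one") is PROVED from
  `rank_colFactor_add_le` / `rank_rowFactor_add_le` (`GouveiaRobinsonThomas2013_ex27`, appended).
* **Remark 4.6** (p11: the prism with vertices `(0,0,0),…,(1,2,1)` — its printed `8 × 6` slack matrix
  has a positive Hadamard square root of rank four, hence minimal psd rank `4`, yet no positive
  row/column scaling makes it `0/1`): PROVED for the printed matrix (`GouveiaRobinsonThomas2013_remark46`:
  rank factorization of `⁺√S` over `ℚ(√2)` plus a rational `4 × 4` minor; `rank_psd ≥ 4` by a `4 × 4`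
  triangular pattern; the `[[1,1],[2,1]]` obstruction to scaling), appended.
* **Proposition 4.4** (p10: "There is no `2`-level polytope that is combinatorially equivalent to a
  double simplex except in the plane"), as its printed algebraic core: the `0/1` support matrix
  `doubleSimplexSupport n = [[0|1],[I_n|I_n],[1|0]]` is of the slack form `β_j − a_jᵀp_i` with
  `p_i ∈ ℝⁿ` only if `n = 2` (left kernel `z = (1,−1,…,−1,1)` versus the all-ones column of `[1 p_i]`):
  PROVED (`GouveiaRobinsonThomas2013_prop44`, appended).
* **Lemma 2.4** (rank-one factorizations ⟺ Hadamard square roots) is the tree's FGPRT Prop. 6.2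
  (`HasHadamardSqrtOfRankLE.exists_rankOne_psdFactorization`, `FawziEtAl2015_prop62_holds`), used here.
* **Theorem 4.3** (p10: "Any full-dimensional polytope in `ℝⁿ` with `n+2` vertices has psd rank
  `n+1`"), as its matrix step `hasHadamardSqrtOfRankLE_of_vecMul_eq_zero` (the signed square root
  trick: a nonnegative matrix with `≤ 2` nonzero entries per column and a nonzero left kernel vector has
  `rank_√ ≤ #rows − 1`) and, for polygons, `IsConvexPolygon.hasPsdFactorization_three_of_eq_four`
  ("all quadrilaterals have psd rank three").
* **Theorem 4.7** (p11: "A convex polygon `P` in the plane has psd rank three if and only if it has at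
  most four vertices"): `GouveiaRobinsonThomas2013_thm47`, with `IsConvexPolygon.four_le_of_hasPsdFactorization`
  (`m`-gons, `m ≥ 5`, have `rank_psd S_P ≥ 4` while `rank S_P = 3` — a psd-rank lower bound that no
  support-based argument gives, GRT Remark 3.3 / FGPRT §5.2) and
  `IsConvexPolygon.three_le_of_hasPsdFactorization`. The polygon is given by its vertex list
  `x : Fin m → ℝ²` in counterclockwise strictly convex position (`IsConvexPolygon`) and `S_P` is the
  vertex/edge slack matrix `polygonSlack x (i,j) = det(x_{j+1} − x_j, x_i − x_j)` (GRT's `S_P` up to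
  positive column scaling, which psd rank ignores, `hasPsdFactorization_rescale_iff`). The printed
  proof is followed: rank-one factors (Prop. 2.6 — here obtained LOCALLY, from `2 × 2` triangular
  patterns around five consecutive vertices, `not_hasPsdFactorization_three_of_pentagonal`, so no
  polarity is needed), Lemma 2.4, and the `4 × 4` computation "`±√(α−β) = ±√α ± √β` … imply `α = β`",
  done coordinate-free on left kernel vectors (`pentagonalCore_vecMul_eq_zero`: with `u = JF/E`,
  `w = IHQ/(GP)` the kernel relations give `k = u² − w²` for `S` and `K = u − w` for `√S`, whence
  `w = u`, `K = 0`), instead of the printed affine normalisation to `(0,0),(1,0),(0,1),(a,b),(c,d)`.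
* **Example 3.6** (p07–p08): the pentagon `(0,0),(1,0),(2,1),(1,2),(0,1)` and the regular hexagon,
  with the printed matrices `S_P`, `S_H` (`grtPentagonSlack`, `grtHexagonSlack`; shown equal to scaled
  `polygonSlack` of the vertex lists, the hexagon through an affinely regular integer model) and the
  printed size-`4` factorizations verified (`hasPsdFactorization_grtPentagonSlack_four`,
  `hasPsdFactorization_grtHexagonSlack_four`): `rank_psd S_P = rank_psd S_H = 4` EXACTLY
  (`grtPentagonSlack_psdRank`, `grtHexagonSlack_psdRank`) — explicit rank-`3` matrices of psd rank `4`.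

* (appended) **Theorem 4.3 in the `V`/`H` vocabulary** (`GouveiaRobinsonThomas2013_thm43`: `n + 2`
  points, facet columns ⇒ `rank_psd = n + 1`), **Prop. 3.2 second statement for facet columns**
  (`rank_facetFactor_le_one`: in a `S^{n+1}_+`-factorization of a `V`/`H` polytope the factor of a
  facet-defining inequality has rank `≤ 1`), **Prop. 3.7** in its matrix form
  (`GouveiaRobinsonThomas2013_prop37_matrix`: `rank_psd [S 0; 0 α] = rank_psd S + 1`), **Thm. 3.5 for
  polygons** (`GouveiaRobinsonThomas2013_thm35_polygon`: `rank_√ S_P ≤ 3 ⟺ rank_psd S_P ≤ 3`), the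
  `H`-description of a convex polygon (`IsConvexPolygon.convexHull_eq`: `conv{x_i}` = the intersection
  of the edge half-planes, by the fan triangulation) and hence, through FGPRT Thm. 3.3
  (`FawziEtAl2015_thm33_holds`), **Theorem 4.7 as a statement on psd LIFTS**:
  `GouveiaRobinsonThomas2013_thm47_lift` (a convex polygon is a linear image of an affine slice of
  `S^3_+` iff it has `≤ 4` vertices), `IsConvexPolygon.four_le_of_hasPsdLift` (`m ≥ 5` ⇒ every psd lift
  has size `≥ 4`), `IsConvexPolygon.three_le_of_hasPsdLift`.
* (appended) **Prop. 3.2 second statement for vertex rows** (`rank_vertexFactor_le_one`): for a point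
  `x_p` strictly separated from the other points by a linear functional (a vertex), the factor `A_p`
  of a `S^{n+1}_+`-factorization has rank `≤ 1` — proved through the VERTEX FIGURE (the tight columns,
  on the rows `x_i ≠ x_p` rescaled by `cᵀ(x_i − x_p)`, are the slack matrix of the `(n−1)`-polytope
  `{y : a_jᵀy ≤ b_j (j tight at x_p), cᵀy = cᵀx_p + 1} = conv{x_p + (x_i − x_p)/cᵀ(x_i − x_p)}`, the
  cone of feasible directions at a vertex being cut out by the tight inequalities) instead of the
  printed polarity; hence **Prop. 3.2 in full** (`GouveiaRobinsonThomas2013_prop32_rankOne`: vertex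
  rows, facet columns ⇒ all factors rank one) and **Theorem 3.5** (`GouveiaRobinsonThomas2013_thm35`:
  `rank_psd S_P = n + 1 ⟺ rank_√ S_P = n + 1`, typed as `S_P` has a `S^{n+1}_+`-factorization iff a
  Hadamard square root of rank `≤ n + 1`, for `n ≥ 2`).

NOT here: the `ℝ³` classification (Thm. 4.8 biplanar octahedra, Lemma 4.9, Prop. 4.10, Thms. 4.11–4.12),
the case `n = 1` of Thm. 3.5 (segments), the pyramid's `V`/`H` description in Prop. 3.7, Prop. 4.4,
Ex. 4.5 / Remark 4.6 (Macaulay2 computations).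
-/

noncomputable section

open Matrix Finset
open scoped MatrixOrder

namespace Literature.Combinatorics.Optimization

/-! ### Compression of a psd factorization to the kernel of one factor (GRT 2013, Prop. 2.6) -/

section Compression

variable {K m : ℕ} {G : Submodule ℝ (EuclideanSpace ℝ (Fin K))}

/-- The `K × m` matrix whose columns are an orthonormal basis of a subspace `G ⊆ ℝ^K`. [folklore] -/
private def onbMat (b : OrthonormalBasis (Fin m) ℝ G) : Matrix (Fin K) (Fin m) ℝ :=
  Matrix.of fun s a => (b a : EuclideanSpace ℝ (Fin K)) s

/-- `Q Qᵀ v = v` for `v ∈ G` (`Q Qᵀ` is the orthogonal projection onto `G`). [folklore] -/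
private theorem onbMat_proj_mulVec (b : OrthonormalBasis (Fin m) ℝ G)
    {v : EuclideanSpace ℝ (Fin K)} (hv : v ∈ G) :
    (onbMat b * (onbMat b)ᵀ) *ᵥ v.ofLp = v.ofLp := by
  classical
  funext s
  have h := b.sum_repr' ⟨v, hv⟩
  have h2 := congrArg (fun w : G => (w : EuclideanSpace ℝ (Fin K)) s) h
  simp only [Submodule.coe_sum, Submodule.coe_smul, Submodule.coe_inner] at h2
  have h3 : ∑ a, (inner ℝ (b a : EuclideanSpace ℝ (Fin K)) v) *
      (b a : EuclideanSpace ℝ (Fin K)) s = v s := by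
    simpa [WithLp.ofLp_sum, Finset.sum_apply, smul_eq_mul] using h2
  rw [← mulVec_mulVec]
  change _ = v s
  rw [← h3]
  simp only [mulVec, dotProduct, onbMat, transpose_apply, of_apply]
  refine sum_congr rfl fun a _ => ?_
  rw [mul_comm]
  congr 1
  simp [PiLp.inner_apply, mul_comm]

/-- `Q Qᵀ A = A` when the columns of `A` lie in `G`. [folklore] -/
private theorem onbMat_proj_mul (b : OrthonormalBasis (Fin m) ℝ G) {A : Matrix (Fin K) (Fin K) ℝ}
    (hrange : ∀ w : Fin K → ℝ, WithLp.toLp 2 (A *ᵥ w) ∈ G) :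
    onbMat b * (onbMat b)ᵀ * A = A := by
  classical
  ext s t
  have h := congrFun (onbMat_proj_mulVec b (hrange (Pi.single t 1))) s
  simp only [mulVec_mulVec] at h
  simpa [Matrix.mulVec_single_one] using h

/-- Compression to `G`: `Tr(QᵀAQ · QᵀBQ) = Tr(A B)` when `A` is symmetric with columns in `G`.
[folklore] -/
private theorem trace_compress' (b : OrthonormalBasis (Fin m) ℝ G) {A B : Matrix (Fin K) (Fin K) ℝ}
    (hA : Aᵀ = A) (hrange : ∀ w : Fin K → ℝ, WithLp.toLp 2 (A *ᵥ w) ∈ G) :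
    ((onbMat b)ᵀ * A * onbMat b * ((onbMat b)ᵀ * B * onbMat b)).trace = (A * B).trace := by
  set Q := onbMat b with hQ
  have hPA : Q * Qᵀ * A = A := onbMat_proj_mul b hrange
  have hAP : A * (Q * Qᵀ) = A := by
    have h := congrArg transpose hPA
    rw [transpose_mul, transpose_mul, transpose_transpose, hA] at h
    exact h
  calc (Qᵀ * A * Q * (Qᵀ * B * Q)).trace = ((Qᵀ * A * Q * Qᵀ * B) * Q).trace := by
        simp only [Matrix.mul_assoc]
    _ = (Q * (Qᵀ * A * Q * Qᵀ * B)).trace := Matrix.trace_mul_comm _ _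
    _ = ((Q * Qᵀ * A) * (Q * Qᵀ) * B).trace := by simp only [Matrix.mul_assoc]
    _ = (A * B).trace := by rw [hPA, hAP]

end Compression

/-- **GRT Proposition 2.6, the mechanism** (p05–p06: "Let `r = rank(B) > 0` … `U^{-1} B U = diag(λ_1,…,
λ_r,0,…,0)` … `⟨D, A_i'⟩ = 0` implies that the first `r` rows and columns of `A_i'` are all zero …
Thus, there exists a `S^{k-r}_+`-factorization of `M`"): if psd matrices `A_i` of size `K` are all
trace-orthogonal to one psd matrix `C`, then the matrix `(Tr(A_i B_j))_{ij}` has a psd factorization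
of size `K − rank C` (compress every factor to `ker C ⊇ range A_i` by an orthonormal basis).
[cite: GouveiaRobinsonThomas2013, Prop. 2.6 proof (p05–p06)] -/
theorem hasPsdFactorization_trace_of_orthogonal {ι κ : Type*} {K : ℕ}
    (A : ι → Matrix (Fin K) (Fin K) ℝ) (B : κ → Matrix (Fin K) (Fin K) ℝ)
    (hA : ∀ i, (A i).PosSemidef) (hB : ∀ j, (B j).PosSemidef)
    (C : Matrix (Fin K) (Fin K) ℝ) (hC : C.PosSemidef) (hAC : ∀ i, (A i * C).trace = 0) :
    HasPsdFactorization (fun i j => (A i * B j).trace) (K - C.rank) := by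
  classical
  have hAt : ∀ i, (A i)ᵀ = A i := fun i => by
    simpa [conjTranspose_eq_transpose_of_trivial] using (hA i).1.eq
  have hCt : Cᵀ = C := by simpa [conjTranspose_eq_transpose_of_trivial] using hC.1.eq
  have hCA : ∀ i, C * A i = 0 := fun i => by
    have h := mul_eq_zero_of_posSemidef_trace_eq_zero (hA i) hC (hAC i)
    rw [← hCt, ← hAt i, ← transpose_mul, h, transpose_zero]
  -- `G = ker C`, transported to `EuclideanSpace`
  let eW : EuclideanSpace ℝ (Fin K) ≃ₗ[ℝ] (Fin K → ℝ) := WithLp.linearEquiv 2 ℝ (Fin K → ℝ)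
  let G : Submodule ℝ (EuclideanSpace ℝ (Fin K)) :=
    (LinearMap.ker C.mulVecLin).map (eW.symm : (Fin K → ℝ) →ₗ[ℝ] EuclideanSpace ℝ (Fin K))
  have hGmem : ∀ v : EuclideanSpace ℝ (Fin K), v ∈ G ↔ C *ᵥ v.ofLp = 0 := fun v => by
    rw [Submodule.mem_map_equiv, LinearEquiv.symm_symm, LinearMap.mem_ker, Matrix.mulVecLin_apply]
    exact Iff.rfl
  have hAG : ∀ i (w : Fin K → ℝ), WithLp.toLp 2 (A i *ᵥ w) ∈ G := fun i w => by
    rw [hGmem, WithLp.ofLp_toLp, mulVec_mulVec, hCA i, zero_mulVec]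
  -- dimension count: `dim ker C = K − rank C`
  have hdim : Module.finrank ℝ G = K - C.rank := by
    have h2 : C.rank + Module.finrank ℝ (LinearMap.ker C.mulVecLin) = K := by
      have := LinearMap.finrank_range_add_finrank_ker C.mulVecLin
      rw [Module.finrank_fintype_fun_eq_card, Fintype.card_fin] at this
      exact this
    have h3 : Module.finrank ℝ G = Module.finrank ℝ (LinearMap.ker C.mulVecLin) :=
      LinearEquiv.finrank_map_eq _ _
    omega
  let bG := stdOrthonormalBasis ℝ G
  have h : HasPsdFactorization (fun i j => (A i * B j).trace) (Module.finrank ℝ G) := by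
    refine ⟨fun i => (onbMat bG)ᵀ * A i * onbMat bG, fun j => (onbMat bG)ᵀ * B j * onbMat bG,
      fun i => ?_, fun j => ?_, fun i j => ?_⟩
    · simpa [conjTranspose_eq_transpose_of_trivial] using (hA i).conjTranspose_mul_mul_same (onbMat bG)
    · simpa [conjTranspose_eq_transpose_of_trivial] using (hB j).conjTranspose_mul_mul_same (onbMat bG)
    · rw [trace_compress' bG (hAt i) (hAG i)]
  exact hdim ▸ h

/-- A nonzero real matrix has positive rank (a nonzero column is a nonzero vector of the column
space). [folklore] -/
private theorem one_le_rank_of_ne_zero {p q : Type*} [Fintype p] [Fintype q] {M : Matrix p q ℝ}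
    (hM : M ≠ 0) : 1 ≤ M.rank := by
  classical
  obtain ⟨i, j, hij⟩ : ∃ i j, M i j ≠ 0 := by
    by_contra h
    push Not at h
    exact hM (Matrix.ext fun i j => by rw [h i j]; rfl)
  unfold Matrix.rank
  refine Module.finrank_pos_iff_exists_ne_zero.mpr
    ⟨⟨M.mulVecLin (Pi.single j 1), LinearMap.mem_range_self _ _⟩, fun h => hij ?_⟩
  have h' := congrArg (fun v : LinearMap.range M.mulVecLin => (v : p → ℝ) i) h
  simpa [Matrix.mulVec, dotProduct, Pi.single_apply] using h'

/-- **GRT Proposition 2.6, rank of a column factor** (p05–p06): in a psd factorization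
`M_{ij} = Tr(A_iB_j)` of size `K`, if the rows on which column `c` vanishes admit no psd factorization
of size `< n`, then `rank(B_c) + n ≤ K` (the rows vanishing at `c` have factors trace-orthogonal to
`B_c`, so they factor in size `K − rank B_c`). [cite: GouveiaRobinsonThomas2013, Prop. 2.6 (p05–p06)] -/
theorem rank_colFactor_add_le {ι κ : Type*} {K : ℕ} {M : ι → κ → ℝ}
    (A : ι → Matrix (Fin K) (Fin K) ℝ) (B : κ → Matrix (Fin K) (Fin K) ℝ)
    (hA : ∀ i, (A i).PosSemidef) (hB : ∀ j, (B j).PosSemidef)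
    (hM : ∀ i j, M i j = (A i * B j).trace) (c : κ) {n : ℕ}
    (hlow : ∀ k, HasPsdFactorization (fun (i : {i // M i c = 0}) j => M i.1 j) k → n ≤ k) :
    (B c).rank + n ≤ K := by
  have h := hasPsdFactorization_trace_of_orthogonal (fun i : {i // M i c = 0} => A i.1) B
    (fun i => hA i.1) hB (B c) (hB c) (fun i => by rw [← hM]; exact i.2)
  have h' : HasPsdFactorization (fun (i : {i // M i c = 0}) j => M i.1 j) (K - (B c).rank) := by
    have e : (fun (i : {i // M i c = 0}) j => M i.1 j) = fun i j => (A i.1 * B j).trace :=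
      funext fun i => funext fun j => hM i.1 j
    rw [e]; exact h
  have h1 := hlow _ h'
  have h2 : (B c).rank ≤ K := by
    simpa using Matrix.rank_le_width (B c)
  omega

/-- **GRT Proposition 2.6, rank of a row factor** (p05–p06, transposed form): in a psd factorization
`M_{ij} = Tr(A_iB_j)` of size `K`, if the columns on which row `r` vanishes admit no psd factorization
of size `< n`, then `rank(A_r) + n ≤ K`. [cite: GouveiaRobinsonThomas2013, Prop. 2.6 (p05–p06)] -/
theorem rank_rowFactor_add_le {ι κ : Type*} {K : ℕ} {M : ι → κ → ℝ}
    (A : ι → Matrix (Fin K) (Fin K) ℝ) (B : κ → Matrix (Fin K) (Fin K) ℝ)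
    (hA : ∀ i, (A i).PosSemidef) (hB : ∀ j, (B j).PosSemidef)
    (hM : ∀ i j, M i j = (A i * B j).trace) (r : ι) {n : ℕ}
    (hlow : ∀ k, HasPsdFactorization (fun i (j : {j // M r j = 0}) => M i j.1) k → n ≤ k) :
    (A r).rank + n ≤ K := by
  refine rank_colFactor_add_le (M := fun j i => M i j) B A hB hA
    (fun j i => by rw [hM, Matrix.trace_mul_comm]) r fun k hk => hlow k ?_
  exact hk.transpose

/-- **GRT Proposition 2.6, second statement** (p05, verbatim): "Suppose `M ∈ ℝ^{p×q}_+` and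
`rank_psd M = k`. If `M` is extended to `M' = [M 0; w α]` where `w ∈ ℝ^q_+`, `α > 0` and `0` is a column
of zeros, then `rank_psd M' = k+1`. Further, the factor associated to the last column of `M'` in any
`S^{k+1}_+`-factorization of `M'` has rank one." Typed: the second statement, for `M'` the block matrix
on `ι ⊕ Unit`, `κ ⊕ Unit`, under `rank_psd M ≥ k` (no psd factorization of `M` of size `< k`) and
`α ≠ 0` (nonnegativity of `M, w, α` is not needed); the first statement is the tree's
`HasPsdFactorization.exists_lt_of_bordered` / `FawziEtAl2015_thm210_holds` with
`HasPsdFactorization.fromBlocks_diag`-type padding. [cite: GouveiaRobinsonThomas2013, Prop. 2.6 (p05–p06)] -/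
theorem GouveiaRobinsonThomas2013_prop26_rankOne {ι κ : Type*} (M : ι → κ → ℝ) (w : κ → ℝ) (α : ℝ)
    (hα : α ≠ 0) {k : ℕ} (hk : ∀ k', HasPsdFactorization M k' → k ≤ k')
    (A : ι ⊕ Unit → Matrix (Fin (k + 1)) (Fin (k + 1)) ℝ)
    (B : κ ⊕ Unit → Matrix (Fin (k + 1)) (Fin (k + 1)) ℝ)
    (hA : ∀ i, (A i).PosSemidef) (hB : ∀ j, (B j).PosSemidef)
    (hM : ∀ i j, Matrix.fromBlocks (Matrix.of M) 0 (Matrix.of fun (_ : Unit) j => w j)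
      (Matrix.of fun (_ : Unit) (_ : Unit) => α) i j = (A i * B j).trace) :
    (B (Sum.inr ())).rank = 1 := by
  set M' : ι ⊕ Unit → κ ⊕ Unit → ℝ := fun i j => Matrix.fromBlocks (Matrix.of M) 0
    (Matrix.of fun (_ : Unit) j => w j) (Matrix.of fun (_ : Unit) (_ : Unit) => α) i j with hM'
  have hle : (B (Sum.inr ())).rank + k ≤ k + 1 := by
    refine rank_colFactor_add_le (M := M') A B hA hB hM (Sum.inr ()) fun k' hk' => hk k' ?_
    -- the rows of `M'` vanishing in the last column contain all rows of `M`
    have hz : ∀ i : ι, M' (Sum.inl i) (Sum.inr ()) = 0 := fun i => by simp [hM']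
    have := hk'.submatrix (fun i : ι => (⟨Sum.inl i, hz i⟩ : {i // M' i (Sum.inr ()) = 0}))
      (fun j : κ => Sum.inl j)
    simpa [hM'] using this
  have hne : B (Sum.inr ()) ≠ 0 := by
    intro h0
    have := hM (Sum.inr ()) (Sum.inr ())
    rw [h0, Matrix.mul_zero, trace_zero] at this
    exact hα (by simpa using this)
  have h1 := one_le_rank_of_ne_zero hne
  omega


/-! ### Left kernel vectors and rank (plumbing) -/

/-- A nonzero left kernel vector forces `rank < #rows`. [folklore] -/
private theorem rank_add_one_le_card_of_vecMul_eq_zero {p q : Type*} [Fintype p] [Fintype q]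
    (N : Matrix p q ℝ) {v : p → ℝ} (hv : v ≠ 0) (hvN : v ᵥ* N = 0) :
    N.rank + 1 ≤ Fintype.card p := by
  classical
  have hker : v ∈ LinearMap.ker Nᵀ.mulVecLin := by
    rw [LinearMap.mem_ker, Matrix.mulVecLin_apply, Matrix.mulVec_transpose, hvN]
  have h1 : 1 ≤ Module.finrank ℝ (LinearMap.ker Nᵀ.mulVecLin) := by
    refine Module.finrank_pos_iff_exists_ne_zero.mpr ⟨⟨v, hker⟩, fun h => hv ?_⟩
    simpa using congrArg Subtype.val h
  have h2 : Nᵀ.rank + Module.finrank ℝ (LinearMap.ker Nᵀ.mulVecLin) = Fintype.card p := by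
    have := LinearMap.finrank_range_add_finrank_ker Nᵀ.mulVecLin
    rw [Module.finrank_fintype_fun_eq_card] at this
    exact this
  rw [Matrix.rank_transpose] at h2
  omega

/-- `rank < #rows` yields a nonzero left kernel vector. [folklore] -/
private theorem exists_vecMul_eq_zero_of_rank_lt_card {p q : Type*} [Fintype p] [Fintype q]
    (N : Matrix p q ℝ) (h : N.rank < Fintype.card p) : ∃ v : p → ℝ, v ≠ 0 ∧ v ᵥ* N = 0 := by
  classical
  have h2 : Nᵀ.rank + Module.finrank ℝ (LinearMap.ker Nᵀ.mulVecLin) = Fintype.card p := by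
    have := LinearMap.finrank_range_add_finrank_ker Nᵀ.mulVecLin
    rw [Module.finrank_fintype_fun_eq_card] at this
    exact this
  rw [Matrix.rank_transpose] at h2
  have h1 : 0 < Module.finrank ℝ (LinearMap.ker Nᵀ.mulVecLin) := by omega
  obtain ⟨⟨v, hv⟩, hne⟩ := Module.finrank_pos_iff_exists_ne_zero.mp h1
  refine ⟨v, fun h0 => hne (Subtype.ext h0), ?_⟩
  rw [LinearMap.mem_ker, Matrix.mulVecLin_apply, Matrix.mulVec_transpose] at hv
  exact hv

/-! ### Theorem 4.3: the signed square root trick -/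

/-- The signed square root `sgn(u)·√|u|`. [cite: GouveiaRobinsonThomas2013, Thm. 4.3 proof (p10)] -/
private def ssqrt (u : ℝ) : ℝ := if 0 ≤ u then Real.sqrt u else -Real.sqrt (-u)

/-- `ssqrt u · |ssqrt u| = u`. [folklore] -/
private theorem ssqrt_mul_abs (u : ℝ) : ssqrt u * |ssqrt u| = u := by
  unfold ssqrt
  split_ifs with h
  · rw [abs_of_nonneg (Real.sqrt_nonneg _), ← sq, Real.sq_sqrt h]
  · push Not at h
    rw [abs_of_nonpos (neg_nonpos.mpr (Real.sqrt_nonneg _)), neg_neg, neg_mul, ← sq,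
      Real.sq_sqrt (by linarith), neg_neg]

/-- `ssqrt u ≠ 0` for `u ≠ 0`. [folklore] -/
private theorem ssqrt_ne_zero {u : ℝ} (hu : u ≠ 0) : ssqrt u ≠ 0 := by
  intro h
  have := ssqrt_mul_abs u
  rw [h, zero_mul] at this
  exact hu this.symm

/-- `t ↦ t·|t|` is injective (it is strictly monotone). [folklore] -/
private theorem eq_of_mul_abs_eq {s t : ℝ} (h : s * |s| = t * |t|) : s = t := by
  rcases le_or_gt 0 s with hs | hs <;> rcases le_or_gt 0 t with ht | ht
  · rw [abs_of_nonneg hs, abs_of_nonneg ht] at h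
    nlinarith
  · rw [abs_of_nonneg hs, abs_of_neg ht] at h
    nlinarith
  · rw [abs_of_neg hs, abs_of_nonneg ht] at h
    nlinarith
  · rw [abs_of_neg hs, abs_of_neg ht] at h
    nlinarith

/-- On a set of at most two indices, `Σ g_i = 0` with `f_i |f_i| = g_i` forces `Σ f_i = 0`
(the sign bookkeeping of GRT Thm. 4.3). [cite: GouveiaRobinsonThomas2013, Thm. 4.3 proof (p10)] -/
private theorem sum_eq_zero_of_card_le_two {p : Type*} {s : Finset p} (hs : s.card ≤ 2)
    (f g : p → ℝ) (hfg : ∀ i, f i * |f i| = g i) (hg : ∑ i ∈ s, g i = 0) :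
    ∑ i ∈ s, f i = 0 := by
  classical
  rcases Nat.lt_or_ge s.card 1 with h0 | h1
  · rw [Finset.card_eq_zero.mp (show s.card = 0 by omega), Finset.sum_empty]
  rcases Nat.lt_or_ge s.card 2 with h1' | h2
  · obtain ⟨a, ha⟩ := Finset.card_eq_one.mp (show s.card = 1 by omega)
    rw [ha, Finset.sum_singleton] at hg ⊢
    have h2 : f a * |f a| = 0 * |(0:ℝ)| := by rw [hfg, hg]; simp
    exact eq_of_mul_abs_eq h2
  · obtain ⟨a, b, hab, hs2⟩ := Finset.card_eq_two.mp (le_antisymm hs h2)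
    rw [hs2, Finset.sum_pair hab] at hg ⊢
    have h2 : f a * |f a| = (-f b) * |-f b| := by
      rw [abs_neg, hfg, neg_mul, hfg]; linarith
    rw [eq_of_mul_abs_eq h2]; ring

/-- **GRT Theorem 4.3, the matrix step** (p10: "Since `rank S_P = n+1`, we have `Σ a_i S_i = 0` …
Each column of `S_P` must have at least `n` zeros, so … all but at most two of the summands must be
zero … define `b_i := sgn(a_i)√|a_i|`. Then `b_{i_0}√(S_{i_0})_j + b_{i_1}√(S_{i_1})_j = 0` … Thus
`√⁺S_P` must have rank `n+1`"): a nonnegative matrix with at most two nonzero entries in each column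
and a nonzero left kernel vector has a Hadamard square root (the all-nonnegative one) of rank
`≤ #rows − 1`. [cite: GouveiaRobinsonThomas2013, Thm. 4.3 proof (p10)] -/
theorem hasHadamardSqrtOfRankLE_of_vecMul_eq_zero {p q : Type*} [Fintype p] [Fintype q]
    [DecidableEq p] (M : Matrix p q ℝ) (hM : ∀ i j, 0 ≤ M i j)
    (hcol : ∀ j, (Finset.univ.filter fun i => M i j ≠ 0).card ≤ 2)
    {u : p → ℝ} (hu : u ≠ 0) (huM : u ᵥ* M = 0) :
    HasHadamardSqrtOfRankLE M (Fintype.card p - 1) := by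
  classical
  let v : p → ℝ := fun i => ssqrt (u i)
  have hv : v ≠ 0 := by
    obtain ⟨i, hi⟩ : ∃ i, u i ≠ 0 := by
      by_contra h
      push Not at h
      exact hu (funext h)
    exact fun h0 => ssqrt_ne_zero hi (congrFun h0 i)
  have hNsq : ∀ i j, (Matrix.of fun i j => Real.sqrt (M i j)) i j ^ 2 = M i j := fun i j => by
    rw [Matrix.of_apply, Real.sq_sqrt (hM i j)]
  -- the key computation, column by column
  have hvN : v ᵥ* (Matrix.of fun i j => Real.sqrt (M i j)) = 0 := by
    funext j
    have hmem : ∀ i, i ∈ (Finset.univ.filter fun i => M i j ≠ 0) ↔ M i j ≠ 0 := fun i => by simp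
    have hsumN : (v ᵥ* (Matrix.of fun i j => Real.sqrt (M i j))) j =
        ∑ i ∈ Finset.univ.filter (fun i => M i j ≠ 0), v i * Real.sqrt (M i j) := by
      rw [Matrix.vecMul, dotProduct, ← Finset.sum_subset (Finset.subset_univ _)]
      · rfl
      · intro i _ hi
        have h0 : M i j = 0 := by simpa using hi
        simp [h0]
    have hsumM : ∑ i ∈ Finset.univ.filter (fun i => M i j ≠ 0), u i * M i j = 0 := by
      have h := congrFun huM j
      rw [Matrix.vecMul, dotProduct, ← Finset.sum_subset (Finset.subset_univ _)] at h
      · exact h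
      · intro i _ hi
        have h0 : M i j = 0 := by simpa using hi
        simp [h0]
    rw [hsumN, Pi.zero_apply]
    refine sum_eq_zero_of_card_le_two (hcol j) (fun i => v i * Real.sqrt (M i j))
      (fun i => u i * M i j) (fun i => ?_) hsumM
    have hNn : 0 ≤ Real.sqrt (M i j) := Real.sqrt_nonneg _
    rw [abs_mul, abs_of_nonneg hNn]
    calc v i * Real.sqrt (M i j) * (|v i| * Real.sqrt (M i j))
        = (v i * |v i|) * (Real.sqrt (M i j) * Real.sqrt (M i j)) := by ring
      _ = u i * M i j := by rw [ssqrt_mul_abs, Real.mul_self_sqrt (hM i j)]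
  refine ⟨Matrix.of fun i j => Real.sqrt (M i j), hNsq, ?_⟩
  have := rank_add_one_le_card_of_vecMul_eq_zero _ hv hvN
  omega


/-! ### Theorem 4.7, the algebraic core: the `4 × 4` pentagonal pattern -/

/-- **GRT Theorem 4.7, the computation** (p11: "It is then enough to show that every possible Hadamard
square root of the `4 × 4` upper left portion of this matrix has rank four … `±√(α−β) = ±√α ± √β` …
all of which imply `α = β`"), in coordinate-free form. Rows = four consecutive vertices
`v₂, v₃, v₁, v₄`, columns = the edges `e₂₃, e₁₂, e₃₄, e₀₁` of a convex polygon give the pattern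
`T = [[0,0,p,q],[0,e,0,f],[g,0,h,0],[i,j,0,k]]` with `p,q,e,g,h,i,k ≠ 0`; `T` (a planar slack
matrix) has a nonzero left kernel vector. Then every entrywise square root `N` (`N_{ab}² = T_{ab}`)
of `T` is nonsingular: a left kernel vector `v` of `N` is zero. (With `u = JF/E`, `w = IHQ/(GP)` for
the entries of `N`: the kernel relations give `k = u² − w²` for `T` and `K = u − w` for `N`, whence
`w(w − u) = 0`, `w = u`, `K = 0`, contradicting `k ≠ 0` — the printed "`α = β`".)
[cite: GouveiaRobinsonThomas2013, Thm. 4.7 proof (p11)] -/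
theorem pentagonalCore_vecMul_eq_zero (T N : Matrix (Fin 4) (Fin 4) ℝ)
    (h00 : T 0 0 = 0) (h01 : T 0 1 = 0) (h10 : T 1 0 = 0) (h12 : T 1 2 = 0) (h21 : T 2 1 = 0)
    (h23 : T 2 3 = 0) (h32 : T 3 2 = 0)
    (h02 : T 0 2 ≠ 0) (h03 : T 0 3 ≠ 0) (h11 : T 1 1 ≠ 0) (h20 : T 2 0 ≠ 0) (h22 : T 2 2 ≠ 0)
    (h30 : T 3 0 ≠ 0) (h33 : T 3 3 ≠ 0)
    (hT : ∃ u : Fin 4 → ℝ, u ≠ 0 ∧ u ᵥ* T = 0) (hN : ∀ a b, N a b ^ 2 = T a b)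
    {v : Fin 4 → ℝ} (hv : v ᵥ* N = 0) : v = 0 := by
  obtain ⟨u, hu, huT⟩ := hT
  -- entries of `N`
  have hz : ∀ a b, T a b = 0 → N a b = 0 := fun a b h => by
    have := hN a b; rw [h] at this; exact pow_eq_zero_iff (n := 2) (by norm_num) |>.mp this
  have hnz : ∀ a b, T a b ≠ 0 → N a b ≠ 0 := fun a b h hn => by
    have := hN a b; rw [hn] at this; exact h (by simpa using this.symm)
  have n00 := hz 0 0 h00; have n01 := hz 0 1 h01; have n10 := hz 1 0 h10; have n12 := hz 1 2 h12
  have n21 := hz 2 1 h21; have n23 := hz 2 3 h23; have n32 := hz 3 2 h32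
  have P0 := hnz 0 2 h02; have Q0 := hnz 0 3 h03; have E0 := hnz 1 1 h11; have G0 := hnz 2 0 h20
  have H0 := hnz 2 2 h22; have I0 := hnz 3 0 h30; have K0 := hnz 3 3 h33
  -- the kernel equations of `T`
  have eT : ∀ b, u 0 * T 0 b + u 1 * T 1 b + u 2 * T 2 b + u 3 * T 3 b = 0 := fun b => by
    have := congrFun huT b
    simpa [Matrix.vecMul, dotProduct, Fin.sum_univ_four] using this
  have eT0 := eT 0; have eT1 := eT 1; have eT2 := eT 2; have eT3 := eT 3
  rw [h00, h10] at eT0; rw [h01, h21] at eT1; rw [h12, h32] at eT2; rw [h23] at eT3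
  -- the kernel equations of `N`
  have eN : ∀ b, v 0 * N 0 b + v 1 * N 1 b + v 2 * N 2 b + v 3 * N 3 b = 0 := fun b => by
    have := congrFun hv b
    simpa [Matrix.vecMul, dotProduct, Fin.sum_univ_four] using this
  have eN0 := eN 0; have eN1 := eN 1; have eN2 := eN 2; have eN3 := eN 3
  rw [n00, n10] at eN0; rw [n01, n21] at eN1; rw [n12, n32] at eN2; rw [n23] at eN3
  -- `u₃ ≠ 0`
  have hu3 : u 3 ≠ 0 := by
    intro h3
    have h2 : u 2 = 0 := by
      rw [h3] at eT0
      have : u 2 * T 2 0 = 0 := by linarith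
      exact (mul_eq_zero.mp this).resolve_right h20
    have h1 : u 1 = 0 := by
      rw [h3] at eT1
      have : u 1 * T 1 1 = 0 := by linarith
      exact (mul_eq_zero.mp this).resolve_right h11
    have h0 : u 0 = 0 := by
      rw [h2] at eT2
      have : u 0 * T 0 2 = 0 := by linarith
      exact (mul_eq_zero.mp this).resolve_right h02
    exact hu (funext fun a => by fin_cases a <;> assumption)
  -- eliminate `u₀, u₁, u₂`: (g p e) k u₃ = u₃ (j f g p − i h q e)
  -- from eT0: u2 = -u3 i/g ; eT1: u1 = -u3 j/e ; eT2: u0 p = -u2 h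
  have keyT : T 3 3 * (T 2 0 * T 0 2 * T 1 1) =
      T 3 1 * T 1 3 * T 2 0 * T 0 2 - T 3 0 * T 2 2 * T 0 3 * T 1 1 := by
    -- multiply eT3 by g p e u₃⁻¹-free manipulations
    have e0 : u 2 * T 2 0 = -(u 3 * T 3 0) := by linarith
    have e1 : u 1 * T 1 1 = -(u 3 * T 3 1) := by linarith
    have e2 : u 0 * T 0 2 = -(u 2 * T 2 2) := by linarith
    have e3 : u 0 * T 0 3 + u 1 * T 1 3 + u 3 * T 3 3 = 0 := by linarith
    -- (u0 q + u1 f + u3 k) · g p e = 0, substitute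
    have : u 3 * (T 3 3 * (T 2 0 * T 0 2 * T 1 1) -
        (T 3 1 * T 1 3 * T 2 0 * T 0 2 - T 3 0 * T 2 2 * T 0 3 * T 1 1)) = 0 := by
      have h := congrArg (fun t => t * (T 2 0 * T 0 2 * T 1 1)) e3
      simp only [zero_mul] at h
      -- u0 T02 = -(u2 T22); u2 T20 = -(u3 T30); u1 T11 = -(u3 T31)
      linear_combination h - (T 0 3 * T 2 0 * T 1 1) * e2 + (T 2 2 * T 0 3 * T 1 1) * e0
        - (T 1 3 * T 2 0 * T 0 2) * e1
    have := (mul_eq_zero.mp this).resolve_left hu3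
    linarith
  -- same elimination for `N`, assuming `v₃ ≠ 0`
  by_contra hvne
  have hv3 : v 3 ≠ 0 := by
    intro h3
    have h2 : v 2 = 0 := by
      rw [h3] at eN0
      have : v 2 * N 2 0 = 0 := by linarith
      exact (mul_eq_zero.mp this).resolve_right G0
    have h1 : v 1 = 0 := by
      rw [h3] at eN1
      have : v 1 * N 1 1 = 0 := by linarith
      exact (mul_eq_zero.mp this).resolve_right E0
    have h0 : v 0 = 0 := by
      rw [h2] at eN2
      have : v 0 * N 0 2 = 0 := by linarith
      exact (mul_eq_zero.mp this).resolve_right P0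
    exact hvne (funext fun a => by fin_cases a <;> assumption)
  have keyN : N 3 3 * (N 2 0 * N 0 2 * N 1 1) =
      N 3 1 * N 1 3 * N 2 0 * N 0 2 - N 3 0 * N 2 2 * N 0 3 * N 1 1 := by
    have e0 : v 2 * N 2 0 = -(v 3 * N 3 0) := by linarith
    have e1 : v 1 * N 1 1 = -(v 3 * N 3 1) := by linarith
    have e2 : v 0 * N 0 2 = -(v 2 * N 2 2) := by linarith
    have e3 : v 0 * N 0 3 + v 1 * N 1 3 + v 3 * N 3 3 = 0 := by linarith
    have : v 3 * (N 3 3 * (N 2 0 * N 0 2 * N 1 1) -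
        (N 3 1 * N 1 3 * N 2 0 * N 0 2 - N 3 0 * N 2 2 * N 0 3 * N 1 1)) = 0 := by
      have h := congrArg (fun t => t * (N 2 0 * N 0 2 * N 1 1)) e3
      simp only [zero_mul] at h
      linear_combination h - (N 0 3 * N 2 0 * N 1 1) * e2 + (N 2 2 * N 0 3 * N 1 1) * e0
        - (N 1 3 * N 2 0 * N 0 2) * e1
    have := (mul_eq_zero.mp this).resolve_left hv3
    linarith
  -- square `keyN` and compare with `keyT` through `N_{ab}² = T_{ab}`
  have sq33 := hN 3 3; have sq20 := hN 2 0; have sq02 := hN 0 2; have sq11 := hN 1 1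
  have sq31 := hN 3 1; have sq13 := hN 1 3; have sq30 := hN 3 0; have sq22 := hN 2 2
  have sq03 := hN 0 3
  -- X := N31 N13 N20 N02, Y := N30 N22 N03 N11 ; keyT reads K²G²P²E² = X² − Y², keyN: KGPE = X − Y
  set X := N 3 1 * N 1 3 * N 2 0 * N 0 2 with hX
  set Y := N 3 0 * N 2 2 * N 0 3 * N 1 1 with hY
  have hT' : (N 3 3 * (N 2 0 * N 0 2 * N 1 1)) ^ 2 = X ^ 2 - Y ^ 2 := by
    have : (N 3 3 * (N 2 0 * N 0 2 * N 1 1)) ^ 2 = T 3 3 * (T 2 0 * T 0 2 * T 1 1) := by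
      rw [← sq33, ← sq20, ← sq02, ← sq11]; ring
    rw [this, keyT, hX, hY, ← sq31, ← sq13, ← sq20, ← sq02, ← sq30, ← sq22, ← sq03, ← sq11]; ring
  rw [keyN] at hT'
  -- (X − Y)² = X² − Y²  ⇒  Y (Y − X) = 0
  have hYX : Y * (Y - X) = 0 := by linear_combination (1 / 2 : ℝ) * hT'
  have hY0 : Y ≠ 0 := by
    rw [hY]; exact mul_ne_zero (mul_ne_zero (mul_ne_zero I0 H0) Q0) E0
  have hXY : X = Y := by
    have := (mul_eq_zero.mp hYX).resolve_left hY0; linarith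
  have : N 3 3 * (N 2 0 * N 0 2 * N 1 1) = 0 := by rw [keyN, hXY]; ring
  exact (mul_ne_zero K0 (mul_ne_zero (mul_ne_zero G0 P0) E0)) this


/-! ### Theorem 4.7, the local configuration: five consecutive vertices and edges -/

/-- Rank-one column factors from a `2 × 2` triangular witness (Prop. 2.6 with `n = 2`, `K = 3`).
[cite: GouveiaRobinsonThomas2013, Prop. 2.6 (p05–p06)] -/
private theorem rank_col_le_one_of_flag {ι κ : Type*} {S : ι → κ → ℝ}
    {A : ι → Matrix (Fin 3) (Fin 3) ℝ} {B : κ → Matrix (Fin 3) (Fin 3) ℝ}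
    (hA : ∀ i, (A i).PosSemidef) (hB : ∀ j, (B j).PosSemidef)
    (hS : ∀ i j, S i j = (A i * B j).trace) (c : κ) (ra rb : ι) (hra : S ra c = 0)
    (hrb : S rb c = 0) (γ0 γ1 : κ) (h0 : S ra γ0 ≠ 0) (h01 : S ra γ1 = 0) (h1 : S rb γ1 ≠ 0) :
    (B c).rank ≤ 1 := by
  have h := rank_colFactor_add_le A B hA hB hS c (n := 2) fun k hk =>
    hk.card_le_of_triangular ![⟨ra, hra⟩, ⟨rb, hrb⟩] ![γ0, γ1]
      (fun a => by fin_cases a <;> simpa)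
      (fun a b hab => by
        fin_cases a <;> fin_cases b <;> simp at hab ⊢
        exact h01)
  omega

/-- Rank-one row factors from a `2 × 2` triangular witness (Prop. 2.6 transposed, `n = 2`, `K = 3`).
[cite: GouveiaRobinsonThomas2013, Prop. 2.6 (p05–p06)] -/
private theorem rank_row_le_one_of_flag {ι κ : Type*} {S : ι → κ → ℝ}
    {A : ι → Matrix (Fin 3) (Fin 3) ℝ} {B : κ → Matrix (Fin 3) (Fin 3) ℝ}
    (hA : ∀ i, (A i).PosSemidef) (hB : ∀ j, (B j).PosSemidef)
    (hS : ∀ i j, S i j = (A i * B j).trace) (r : ι) (ca cb : κ) (hca : S r ca = 0)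
    (hcb : S r cb = 0) (ρ0 ρ1 : ι) (h0 : S ρ0 ca ≠ 0) (h01 : S ρ0 cb = 0) (h1 : S ρ1 cb ≠ 0) :
    (A r).rank ≤ 1 := by
  have h := rank_rowFactor_add_le A B hA hB hS r (n := 2) fun k hk =>
    hk.card_le_of_triangular ![ρ0, ρ1] ![⟨ca, hca⟩, ⟨cb, hcb⟩]
      (fun a => by fin_cases a <;> simpa)
      (fun a b hab => by
        fin_cases a <;> fin_cases b <;> simp at hab ⊢
        exact h01)
  omega

/-- **GRT Theorem 4.7, local form** (p11, the proof: by Prop. 3.2 / Thm. 3.5 a `S^3_+`-factorization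
has rank-one factors, by Lemma 2.4 these give a Hadamard square root of rank `≤ 3`, and "every possible
Hadamard square root of the `4 × 4` upper left portion … has rank four"). Typed for an arbitrary
real matrix `S` containing the incidence pattern of five consecutive vertices `r₀,…,r₄` and edges
`c₀ = [r₀,r₁], …, c₄ = [r₄, ·]` of a convex polygon: `S r_t c_t = S r_{t+1} c_t = 0`, the listed
off-edge slacks nonzero, and the `4 × 4` core (rows `r₂,r₃,r₁,r₄`, columns `c₂,c₁,c₃,c₀`) with a
nonzero left kernel vector (automatic for planar slack matrices, which have rank `≤ 3`). Then `S` has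
NO psd factorization of size `3`. The rank-one property is obtained locally: each of the eight core
factors is forced to rank `≤ 1` by Prop. 2.6 and a `2 × 2` triangular pattern among the neighbouring
entries; Lemma 2.4 is the tree's `FawziEtAl2015_prop62_holds`.
[cite: GouveiaRobinsonThomas2013, Thm. 4.7 proof (p11)] -/
theorem not_hasPsdFactorization_three_of_pentagonal {ι κ : Type*} (S : ι → κ → ℝ)
    (r0 r1 r2 r3 r4 : ι) (c0 c1 c2 c3 c4 : κ)
    (z00 : S r0 c0 = 0) (z10 : S r1 c0 = 0) (z11 : S r1 c1 = 0) (z21 : S r2 c1 = 0)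
    (z22 : S r2 c2 = 0) (z32 : S r3 c2 = 0) (z33 : S r3 c3 = 0) (z43 : S r4 c3 = 0)
    (z44 : S r4 c4 = 0)
    (p : S r2 c3 ≠ 0) (q : S r2 c0 ≠ 0) (e : S r3 c1 ≠ 0) (g : S r1 c2 ≠ 0) (h : S r1 c3 ≠ 0)
    (i : S r4 c2 ≠ 0) (k : S r4 c0 ≠ 0) (n01 : S r0 c1 ≠ 0) (n34 : S r3 c4 ≠ 0)
    (hcore : ∃ u : Fin 4 → ℝ, u ≠ 0 ∧
      u ᵥ* (Matrix.of fun a b => S (![r2, r3, r1, r4] a) (![c2, c1, c3, c0] b)) = 0) :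
    ¬ HasPsdFactorization S 3 := by
  classical
  rintro ⟨A, B, hA, hB, hS⟩
  -- the eight core factors have rank `≤ 1`
  have hB0 : (B c0).rank ≤ 1 := rank_col_le_one_of_flag hA hB hS c0 r1 r0 z10 z00 c2 c1 g z11 n01
  have hB1 : (B c1).rank ≤ 1 := rank_col_le_one_of_flag hA hB hS c1 r2 r1 z21 z11 c3 c2 p z22 g
  have hB2 : (B c2).rank ≤ 1 := rank_col_le_one_of_flag hA hB hS c2 r3 r2 z32 z22 c1 c3 e z33 p
  have hB3 : (B c3).rank ≤ 1 := rank_col_le_one_of_flag hA hB hS c3 r3 r4 z33 z43 c1 c2 e z32 i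
  have hA1 : (A r1).rank ≤ 1 := rank_row_le_one_of_flag hA hB hS r1 c0 c1 z10 z11 r2 r3 q z21 e
  have hA2 : (A r2).rank ≤ 1 := rank_row_le_one_of_flag hA hB hS r2 c1 c2 z21 z22 r3 r1 e z32 g
  have hA3 : (A r3).rank ≤ 1 := rank_row_le_one_of_flag hA hB hS r3 c2 c3 z32 z33 r4 r1 i z43 h
  have hA4 : (A r4).rank ≤ 1 := rank_row_le_one_of_flag hA hB hS r4 c4 c3 z44 z43 r3 r1 n34 z33 h
  -- the `4 × 4` core and its Hadamard square root of rank `≤ 3` (Lemma 2.4 = FGPRT Prop. 6.2)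
  set rr : Fin 4 → ι := ![r2, r3, r1, r4] with hrr
  set cc : Fin 4 → κ := ![c2, c1, c3, c0] with hcc
  set T : Matrix (Fin 4) (Fin 4) ℝ := Matrix.of fun a b => S (rr a) (cc b) with hT
  have hArr : ∀ a, (A (rr a)).PosSemidef ∧ (A (rr a)).rank ≤ 1 := fun a => by
    refine ⟨hA _, ?_⟩
    fin_cases a
    · exact hA2
    · exact hA3
    · exact hA1
    · exact hA4
  have hBcc : ∀ b, (B (cc b)).PosSemidef ∧ (B (cc b)).rank ≤ 1 := fun b => by
    refine ⟨hB _, ?_⟩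
    fin_cases b
    · exact hB2
    · exact hB1
    · exact hB3
    · exact hB0
  have hsqrt : HasHadamardSqrtOfRankLE T 3 :=
    FawziEtAl2015_prop62_holds (Fin 4) (Fin 4) T 3
      ⟨fun a => A (rr a), fun b => B (cc b), hArr, hBcc, fun a b => by rw [hT, Matrix.of_apply, hS]⟩
  obtain ⟨N, hN, hNr⟩ := hsqrt
  obtain ⟨v, hv, hvN⟩ := exists_vecMul_eq_zero_of_rank_lt_card N (by simpa using Nat.lt_of_le_of_lt hNr (by norm_num))
  refine hv (pentagonalCore_vecMul_eq_zero T N ?_ ?_ ?_ ?_ ?_ ?_ ?_ ?_ ?_ ?_ ?_ ?_ ?_ ?_ hcore hN hvN)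
  all_goals simp [hT, hrr, hcc]
  all_goals assumption


/-! ### Convex polygons: the vertex/edge slack matrix and Theorem 4.7 -/

section Polygon

variable {m : ℕ} [NeZero m]

/-- The planar cross product `det(u, v) = u₀v₁ − u₁v₀`. [folklore] -/
def cross2 (u v : Fin 2 → ℝ) : ℝ := u 0 * v 1 - u 1 * v 0

/-- **The slack matrix of a polygon from its vertex list** (GRT p02/p07: the slack matrix of a
polytope has rows indexed by the vertices, columns by the facets, entry = slack of the vertex in the
facet inequality). For `x₀,…,x_{m−1} ∈ ℝ²` in cyclic order the facets are the edges `[x_j, x_{j+1}]`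
(indices mod `m`) with inequality `det(x_{j+1} − x_j, y − x_j) ≥ 0`, so the `(i,j)` entry is
`det(x_{j+1} − x_j, x_i − x_j)` (twice the signed area of the triangle `x_j x_{j+1} x_i`; any other
choice of facet normalisations rescales columns by positive reals, which does not change psd ranks).
[cite: GouveiaRobinsonThomas2013, §1 (p02) and Lemma 3.1 (p07)] -/
def polygonSlack (x : Fin m → (Fin 2 → ℝ)) : Matrix (Fin m) (Fin m) ℝ :=
  Matrix.of fun i j => cross2 (x (j + 1) - x j) (x i - x j)

/-- `x₀,…,x_{m−1}` are the vertices of a CONVEX `m`-gon listed counterclockwise: every vertex other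
than `x_j, x_{j+1}` lies strictly on the inner side of the edge line through `x_j, x_{j+1}` (strict
convex position, cyclic order). [cite: GouveiaRobinsonThomas2013, Thm. 4.7 (p11, "convex polygon
with `k` vertices")] -/
def IsConvexPolygon (x : Fin m → (Fin 2 → ℝ)) : Prop :=
  ∀ i j : Fin m, i ≠ j → i ≠ j + 1 → 0 < polygonSlack x i j

/-- Unfolding of `polygonSlack`. [cite: GouveiaRobinsonThomas2013, Lemma 3.1 (p07)] -/
theorem polygonSlack_apply (x : Fin m → (Fin 2 → ℝ)) (i j : Fin m) :
    polygonSlack x i j = (x (j + 1) 0 - x j 0) * (x i 1 - x j 1) - (x (j + 1) 1 - x j 1) * (x i 0 - x j 0) := by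
  simp [polygonSlack, cross2]

/-- A vertex is tight at the edge starting at it. [cite: GouveiaRobinsonThomas2013, Lemma 3.1 (p07)] -/
@[simp] theorem polygonSlack_self (x : Fin m → (Fin 2 → ℝ)) (j : Fin m) : polygonSlack x j j = 0 := by
  simp [polygonSlack, cross2]

/-- A vertex is tight at the edge ending at it. [cite: GouveiaRobinsonThomas2013, Lemma 3.1 (p07)] -/
@[simp] theorem polygonSlack_succ (x : Fin m → (Fin 2 → ℝ)) (j : Fin m) :
    polygonSlack x (j + 1) j = 0 := by
  simp [polygonSlack, cross2]; ring

/-- The slack matrix of a convex polygon is nonnegative. [cite: GouveiaRobinsonThomas2013, §1 (p02)] -/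
theorem IsConvexPolygon.nonneg {x : Fin m → (Fin 2 → ℝ)} (hx : IsConvexPolygon x) (i j : Fin m) :
    0 ≤ polygonSlack x i j := by
  by_cases h1 : i = j
  · rw [h1, polygonSlack_self]
  by_cases h2 : i = j + 1
  · rw [h2, polygonSlack_succ]
  exact (hx i j h1 h2).le

/-- In a convex polygon the entry `(i, j)` vanishes exactly for `i ∈ {j, j+1}`.
[cite: GouveiaRobinsonThomas2013, Lemma 3.1 (p07)] -/
theorem IsConvexPolygon.eq_zero_iff {x : Fin m → (Fin 2 → ℝ)} (hx : IsConvexPolygon x) (i j : Fin m) :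
    polygonSlack x i j = 0 ↔ i = j ∨ i = j + 1 := by
  constructor
  · intro h
    by_contra hne
    push Not at hne
    exact (hx i j hne.1 hne.2).ne' h
  · rintro (rfl | rfl) <;> simp

/-- **GRT Lemma 3.1 for polygons** (p07: "`S_P` … we may factorize … both of the factors have rank
`n+1`"): the slack matrix of a vertex list factors through `ℝ³` (rows `(x_i, 1)`), so every
submatrix of it has rank `≤ 3`. [cite: GouveiaRobinsonThomas2013, Lemma 3.1 (p07)] -/
theorem rank_polygonSlack_submatrix_le {ι' κ' : Type*} [Fintype ι'] [Fintype κ']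
    (x : Fin m → (Fin 2 → ℝ)) (f : ι' → Fin m) (g : κ' → Fin m) :
    (Matrix.of fun a b => polygonSlack x (f a) (g b)).rank ≤ 3 := by
  classical
  set P : Matrix ι' (Fin 3) ℝ := Matrix.of fun a l => ![x (f a) 0, x (f a) 1, 1] l with hP
  set Q : Matrix (Fin 3) κ' ℝ := Matrix.of fun l b =>
    ![-(x (g b + 1) 1 - x (g b) 1), x (g b + 1) 0 - x (g b) 0,
      (x (g b + 1) 1 - x (g b) 1) * x (g b) 0 - (x (g b + 1) 0 - x (g b) 0) * x (g b) 1] l with hQ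
  have hPQ : (Matrix.of fun a b => polygonSlack x (f a) (g b)) = P * Q := by
    ext a b
    simp only [hP, hQ, Matrix.of_apply, Matrix.mul_apply, Fin.sum_univ_three, polygonSlack_apply]
    simp
    ring
  rw [hPQ]
  exact (Matrix.rank_mul_le_left P Q).trans (by simpa using Matrix.rank_le_card_width P)

/-- Hence every `4 × 4` submatrix of a polygon slack matrix has a nonzero left kernel vector.
[cite: GouveiaRobinsonThomas2013, Lemma 3.1 (p07)] -/
theorem exists_vecMul_polygonSlack_four (x : Fin m → (Fin 2 → ℝ)) (f g : Fin 4 → Fin m) :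
    ∃ u : Fin 4 → ℝ, u ≠ 0 ∧ u ᵥ* (Matrix.of fun a b => polygonSlack x (f a) (g b)) = 0 :=
  exists_vecMul_eq_zero_of_rank_lt_card _
    (by simpa using Nat.lt_of_le_of_lt (rank_polygonSlack_submatrix_le x f g) (by norm_num))

/-- Values of successors of small indices in `Fin m` (index bookkeeping). [folklore] -/
private theorem val_add_one_of_lt (j : Fin m) (h : j.val + 1 < m) : (j + 1 : Fin m).val = j.val + 1 := by
  rw [Fin.val_add, Fin.val_one', Nat.add_mod_mod, Nat.mod_eq_of_lt h]

/-- The index `t < m` as an element of `Fin m`. [folklore] -/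
private def idx (t : ℕ) (ht : t < m) : Fin m := ⟨t, ht⟩

/-- Successor of a small index (bookkeeping). [folklore] -/
private theorem idx_succ {t : ℕ} (ht : t + 1 < m) : (idx t (by omega) + 1 : Fin m) = idx (t + 1) ht :=
  Fin.ext (by rw [val_add_one_of_lt _ (by simpa [idx] using ht)]; rfl)

omit [NeZero m] in
/-- Distinct small naturals give distinct indices (bookkeeping). [folklore] -/
private theorem idx_ne {s t : ℕ} (hs : s < m) (ht : t < m) (h : s ≠ t) : idx s hs ≠ idx t ht := by
  intro he; exact h (by simpa [idx] using congrArg Fin.val he)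

/-- **GRT Theorem 4.7, "only if"** (p11, verbatim): "Now suppose that `P` is a convex polygon with `5`
or more vertices … It is then enough to show that every possible Hadamard square root of the `4 × 4`
upper left portion of this matrix has rank four." A convex `m`-gon with `m ≥ 5` has NO
`S^3_+`-factorization of its slack matrix: `rank_psd ≥ 4 > 3 = rank S_P` — a lower bound invisible
to the support (GRT Remark 3.3). Proof: the five consecutive vertices `x₀,…,x₄` and edges
`[x₀,x₁],…,[x₄,x₅]` form the pentagonal configuration of
`not_hasPsdFactorization_three_of_pentagonal`. [cite: GouveiaRobinsonThomas2013, Thm. 4.7 (p11)] -/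
theorem IsConvexPolygon.not_hasPsdFactorization_three {x : Fin m → (Fin 2 → ℝ)}
    (hx : IsConvexPolygon x) (hm : 5 ≤ m) : ¬ HasPsdFactorization (polygonSlack x) 3 := by
  have h0 : (0:ℕ) < m := by omega
  have h1 : (1:ℕ) < m := by omega
  have h2 : (2:ℕ) < m := by omega
  have h3 : (3:ℕ) < m := by omega
  have h4 : (4:ℕ) < m := by omega
  -- positivity of an off-edge slack `S (idx s) (idx t)` for `s ∉ {t, t+1}`
  have pos : ∀ (s t : ℕ) (hs : s < m) (ht : t + 1 < m), s ≠ t → s ≠ t + 1 →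
      polygonSlack x (idx s hs) (idx t (by omega)) ≠ 0 := fun s t hs ht hst hst1 =>
    (hx _ _ (idx_ne hs (by omega) hst) (by rw [idx_succ ht]; exact idx_ne hs ht hst1)).ne'
  -- the last column `c₄ = [x₄, x₅]`: `x₃` is off it (here `x₅ = x₀` when `m = 5`)
  have n34 : polygonSlack x (idx 3 h3) (idx 4 h4) ≠ 0 := by
    refine (hx _ _ (idx_ne h3 h4 (by norm_num)) fun he => ?_).ne'
    have := congrArg Fin.val he
    rw [Fin.val_add, Fin.val_one'] at this
    simp [idx] at this
    rcases Nat.lt_or_ge 5 m with h5 | h5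
    · rw [Nat.mod_eq_of_lt h5] at this; omega
    · have hm5 : m = 5 := by omega
      subst hm5; simp at this
  refine not_hasPsdFactorization_three_of_pentagonal (polygonSlack x)
    (idx 0 h0) (idx 1 h1) (idx 2 h2) (idx 3 h3) (idx 4 h4)
    (idx 0 h0) (idx 1 h1) (idx 2 h2) (idx 3 h3) (idx 4 h4)
    (polygonSlack_self _ _) (by rw [← idx_succ h1, polygonSlack_succ]) (polygonSlack_self _ _)
    (by rw [← idx_succ h2, polygonSlack_succ]) (polygonSlack_self _ _)
    (by rw [← idx_succ h3, polygonSlack_succ]) (polygonSlack_self _ _)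
    (by rw [← idx_succ h4, polygonSlack_succ]) (polygonSlack_self _ _)
    (pos 2 3 h2 h4 (by norm_num) (by norm_num)) (pos 2 0 h2 h1 (by norm_num) (by norm_num))
    (pos 3 1 h3 h2 (by norm_num) (by norm_num)) (pos 1 2 h1 h3 (by norm_num) (by norm_num))
    (pos 1 3 h1 h4 (by norm_num) (by norm_num)) (pos 4 2 h4 h3 (by norm_num) (by norm_num))
    (pos 4 0 h4 h1 (by norm_num) (by norm_num)) (pos 0 1 h0 h2 (by norm_num) (by norm_num)) n34
    (exists_vecMul_polygonSlack_four x _ _)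

/-- **GRT Theorem 4.7, "only if", in rank form**: every psd factorization of the slack matrix of a
convex `m`-gon, `m ≥ 5`, has size `≥ 4`. [cite: GouveiaRobinsonThomas2013, Thm. 4.7 (p11)] -/
theorem IsConvexPolygon.four_le_of_hasPsdFactorization {x : Fin m → (Fin 2 → ℝ)}
    (hx : IsConvexPolygon x) (hm : 5 ≤ m) {k : ℕ} (hk : HasPsdFactorization (polygonSlack x) k) :
    4 ≤ k := by
  by_contra h
  exact hx.not_hasPsdFactorization_three hm (hk.mono (by omega))

/-- **GRT Prop. 3.2 / FGPRT Cor. 5.9 for polygons**: every psd factorization of the slack matrix of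
a convex polygon (`m ≥ 3`) has size `≥ 3` (the triangular pattern on the rows `x₁, x₂, x₀` and the
edges `[x₂,x₃], [x₀,x₁], [x₁,x₂]`). [cite: GouveiaRobinsonThomas2013, Prop. 3.2 (p07)] -/
theorem IsConvexPolygon.three_le_of_hasPsdFactorization {x : Fin m → (Fin 2 → ℝ)}
    (hx : IsConvexPolygon x) (hm : 3 ≤ m) {k : ℕ} (hk : HasPsdFactorization (polygonSlack x) k) :
    3 ≤ k := by
  have h0 : (0:ℕ) < m := by omega
  have h1 : (1:ℕ) < m := by omega
  have h2 : (2:ℕ) < m := by omega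
  -- `x₁` is off the edge `[x₂, x₃]` (for `m = 3`, `x₃ = x₀`)
  have n12 : polygonSlack x (idx 1 h1) (idx 2 h2) ≠ 0 := by
    refine (hx _ _ (idx_ne h1 h2 (by norm_num)) fun he => ?_).ne'
    have := congrArg Fin.val he
    rw [Fin.val_add, Fin.val_one'] at this
    simp [idx] at this
    rcases Nat.lt_or_ge 3 m with h3 | h3
    · rw [Nat.mod_eq_of_lt h3] at this; omega
    · have hm3 : m = 3 := by omega
      subst hm3; simp at this
  have n20 : polygonSlack x (idx 2 h2) (idx 0 h0) ≠ 0 :=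
    (hx _ _ (idx_ne h2 h0 (by norm_num)) (by rw [idx_succ h1]; exact idx_ne h2 h1 (by norm_num))).ne'
  have n01 : polygonSlack x (idx 0 h0) (idx 1 h1) ≠ 0 :=
    (hx _ _ (idx_ne h0 h1 (by norm_num)) (by rw [idx_succ h2]; exact idx_ne h0 h2 (by norm_num))).ne'
  refine hk.card_le_of_triangular ![idx 1 h1, idx 2 h2, idx 0 h0] ![idx 2 h2, idx 0 h0, idx 1 h1]
    (fun a => by fin_cases a <;> assumption) (fun a b hab => ?_)
  fin_cases a <;> fin_cases b <;> simp at hab ⊢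
  · rw [← idx_succ h1, polygonSlack_succ]
  · rw [← idx_succ h2, polygonSlack_succ]

/-- **Triangles and quadrilaterals have a Hadamard square root of rank `≤ 3`** (GRT p10: "any
`n`-polytope with `n+1` vertices is a simplex which is `2`-level, its psd rank is `n+1`" and Thm. 4.3
with `n = 2`, "In the plane, we get that all quadrilaterals have psd rank three", via "`√⁺S_P` must have
rank `n+1`"): for `m = 3` the nonnegative Hadamard square root is `3 × 3`; for `m = 4` each column of the
`4 × 4` slack matrix has exactly two zeros, the matrix has rank `≤ 3`, and the signed square root trick
applies. [cite: GouveiaRobinsonThomas2013, Thm. 4.3 (p10)] -/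
theorem IsConvexPolygon.hasHadamardSqrtOfRankLE_three {x : Fin m → (Fin 2 → ℝ)}
    (hx : IsConvexPolygon x) (hm3 : 3 ≤ m) (hm4 : m ≤ 4) : HasHadamardSqrtOfRankLE (polygonSlack x) 3 := by
  classical
  rcases Nat.lt_or_ge m 4 with hlt | hge
  · have hm : m = 3 := by omega
    refine ⟨Matrix.of fun i j => Real.sqrt (polygonSlack x i j),
      fun i j => by rw [Matrix.of_apply, Real.sq_sqrt (hx.nonneg i j)], ?_⟩
    have := Matrix.rank_le_height (Matrix.of fun i j => Real.sqrt (polygonSlack x i j))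
    simpa [hm] using this
  · have hm : m = 4 := by omega
    have hr : (polygonSlack x).rank ≤ 3 := rank_polygonSlack_submatrix_le x id id
    obtain ⟨u, hu, huS⟩ : ∃ u : Fin m → ℝ, u ≠ 0 ∧ u ᵥ* polygonSlack x = 0 :=
      exists_vecMul_eq_zero_of_rank_lt_card (polygonSlack x) (by simp [hm]; omega)
    have hcol : ∀ j, (Finset.univ.filter fun i => polygonSlack x i j ≠ 0).card ≤ 2 := by
      intro j
      have hsub : (Finset.univ.filter fun i => polygonSlack x i j ≠ 0) ⊆ Finset.univ \ {j, j + 1} := by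
        intro i hi
        simp only [Finset.mem_filter, Finset.mem_univ, true_and] at hi
        simp only [Finset.mem_sdiff, Finset.mem_univ, Finset.mem_insert, Finset.mem_singleton, true_and]
        rintro (rfl | rfl)
        · exact hi (polygonSlack_self _ _)
        · exact hi (polygonSlack_succ _ _)
      refine (Finset.card_le_card hsub).trans ?_
      have hne : j ≠ j + 1 := by
        intro h
        have := congrArg Fin.val h
        rw [Fin.val_add, Fin.val_one'] at this
        subst hm
        omega
      rw [Finset.card_sdiff_of_subset (by intro i _; exact Finset.mem_univ _), Finset.card_univ,
        Fintype.card_fin, Finset.card_pair hne, hm]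
    obtain ⟨N, hN, hNr⟩ := hasHadamardSqrtOfRankLE_of_vecMul_eq_zero (polygonSlack x) hx.nonneg hcol hu huS
    exact ⟨N, hN, by simpa [hm] using hNr⟩

/-- **Triangles have psd rank `3`** (GRT p10: "any `n`-polytope with `n+1` vertices is a simplex which
is `2`-level, its psd rank is `n+1`"). [cite: GouveiaRobinsonThomas2013, §4 (p10)] -/
theorem IsConvexPolygon.hasPsdFactorization_three_of_eq_three {x : Fin m → (Fin 2 → ℝ)}
    (hx : IsConvexPolygon x) (hm : m = 3) : HasPsdFactorization (polygonSlack x) 3 :=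
  (hx.hasHadamardSqrtOfRankLE_three hm.symm.le (by omega)).hasPsdFactorization

/-- **Quadrilaterals have psd rank `3`** (GRT Thm. 4.3 with `n = 2`, p10: "In the plane, we get that all
quadrilaterals have psd rank three"). [cite: GouveiaRobinsonThomas2013, Thm. 4.3 (p10)] -/
theorem IsConvexPolygon.hasPsdFactorization_three_of_eq_four {x : Fin m → (Fin 2 → ℝ)}
    (hx : IsConvexPolygon x) (hm : m = 4) : HasPsdFactorization (polygonSlack x) 3 :=
  (hx.hasHadamardSqrtOfRankLE_three (by omega) hm.le).hasPsdFactorization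

/-- **GRT Theorem 4.7** (p11, verbatim): "A convex polygon `P` in the plane has psd rank three if and
only if it has at most four vertices." Typed for a convex `m`-gon given by its vertices in cyclic
order (`IsConvexPolygon`, `m ≥ 3`) and its vertex/edge slack matrix `polygonSlack` (GRT's `S_P`):
`S_P` has a `S^3_+`-factorization iff `m ≤ 4`; together with
`IsConvexPolygon.three_le_of_hasPsdFactorization` (`rank_psd ≥ 3` always) this is "psd rank three iff
at most four vertices", and `rank_psd S_P ≥ 4` for `m ≥ 5`
(`IsConvexPolygon.four_le_of_hasPsdFactorization`). [cite: GouveiaRobinsonThomas2013, Thm. 4.7 (p11)] -/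
theorem GouveiaRobinsonThomas2013_thm47 {x : Fin m → (Fin 2 → ℝ)} (hx : IsConvexPolygon x)
    (hm : 3 ≤ m) : HasPsdFactorization (polygonSlack x) 3 ↔ m ≤ 4 := by
  constructor
  · intro h
    by_contra h5
    exact hx.not_hasPsdFactorization_three (by omega) h
  · intro h4
    rcases Nat.lt_or_ge m 4 with h3 | h4'
    · exact hx.hasPsdFactorization_three_of_eq_three (by omega)
    · exact hx.hasPsdFactorization_three_of_eq_four (by omega)

/-- **GRT Theorem 3.5 for polygons** (p07, verbatim: "If `P ⊂ ℝⁿ` is a full-dimensional polytope, then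
`rank_psd P = n+1` if and only if `rank_√ S_P = n+1`"), the case `n = 2` in the typed polygon setting:
`S_P` has a Hadamard square root of rank `≤ 3` iff it has a psd factorization of size `3` (both iff
`m ≤ 4`, Theorem 4.7; `⇒` is Prop. 2.2 = FGPRT Cor. 5.3). [cite: GouveiaRobinsonThomas2013, Thm. 3.5 (p07)] -/
theorem GouveiaRobinsonThomas2013_thm35_polygon {x : Fin m → (Fin 2 → ℝ)} (hx : IsConvexPolygon x)
    (hm : 3 ≤ m) : HasHadamardSqrtOfRankLE (polygonSlack x) 3 ↔ HasPsdFactorization (polygonSlack x) 3 := by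
  refine ⟨fun h => h.hasPsdFactorization, fun h => ?_⟩
  exact hx.hasHadamardSqrtOfRankLE_three hm ((GouveiaRobinsonThomas2013_thm47 hx hm).mp h)

end Polygon


/-! ### Example 3.6: the GRT pentagon and the regular hexagon have psd rank exactly `4` -/

section Examples

/-- **GRT Example 3.6, the pentagon** (p07, verbatim): "Consider the pentagon `P` in `ℝ²` with vertices
`(0,0), (1,0), (2,1), (1,2), (0,1)` … `S_P = [[0,4,12,4,0],[0,0,8,8,2],[2,0,0,8,4],[4,8,0,0,2],
[2,8,8,0,0]]`." [cite: GouveiaRobinsonThomas2013, Ex. 3.6 (p07)] -/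
def grtPentagonSlack : Matrix (Fin 5) (Fin 5) ℝ :=
  !![0, 4, 12, 4, 0; 0, 0, 8, 8, 2; 2, 0, 0, 8, 4; 4, 8, 0, 0, 2; 2, 8, 8, 0, 0]

/-- The vertices of the GRT pentagon, counterclockwise. [cite: GouveiaRobinsonThomas2013, Ex. 3.6 (p07)] -/
def grtPentagonVertices : Fin 5 → (Fin 2 → ℝ) := ![![0, 0], ![1, 0], ![2, 1], ![1, 2], ![0, 1]]

/-- **GRT Example 3.6, the regular hexagon** (p07, verbatim): "`S_H = [[0,2,4,4,2,0],[0,0,2,4,4,2],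
[2,0,0,2,4,4],[4,2,0,0,2,4],[4,4,2,0,0,2],[2,4,4,2,0,0]]`" (the slack matrix of a regular hexagon
`H`, normalised to integer entries). [cite: GouveiaRobinsonThomas2013, Ex. 3.6 (p07)] -/
def grtHexagonSlack : Matrix (Fin 6) (Fin 6) ℝ :=
  !![0, 2, 4, 4, 2, 0; 0, 0, 2, 4, 4, 2; 2, 0, 0, 2, 4, 4; 4, 2, 0, 0, 2, 4; 4, 4, 2, 0, 0, 2;
    2, 4, 4, 2, 0, 0]

/-- An affinely regular hexagon with integer vertices (the image of the regular hexagon under a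
linear map; psd rank and the slack matrix up to scaling are affine invariants), counterclockwise.
[cite: GouveiaRobinsonThomas2013, Ex. 3.6 (p07)] -/
def affineHexagonVertices : Fin 6 → (Fin 2 → ℝ) :=
  ![![1, 0], ![1, 1], ![0, 1], ![-1, 0], ![-1, -1], ![0, -1]]

/-- The printed `S_P` is the vertex/edge slack matrix of the pentagon with columns scaled by
`(2, 4, 4, 4, 2)` (GRT normalise facet inequalities to integer coefficients).
[cite: GouveiaRobinsonThomas2013, Ex. 3.6 (p07)] -/
theorem grtPentagonSlack_eq : grtPentagonSlack =
    Matrix.of fun i j => (1 : ℝ) * polygonSlack grtPentagonVertices i j * (![2, 4, 4, 4, 2] : Fin 5 → ℝ) j := by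
  ext i j
  fin_cases i <;> fin_cases j <;>
    simp [grtPentagonSlack, grtPentagonVertices, polygonSlack_apply, Fin.add_def] <;> norm_num

/-- The printed `S_H` is twice the vertex/edge slack matrix of the affinely regular hexagon.
[cite: GouveiaRobinsonThomas2013, Ex. 3.6 (p07)] -/
theorem grtHexagonSlack_eq : grtHexagonSlack =
    Matrix.of fun i j => (1 : ℝ) * polygonSlack affineHexagonVertices i j * (fun _ => (2 : ℝ)) j := by
  ext i j
  fin_cases i <;> fin_cases j <;>
    simp [grtHexagonSlack, affineHexagonVertices, polygonSlack_apply, Fin.add_def] <;> norm_num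

/-- The GRT pentagon is a convex pentagon (vertices in strictly convex cyclic position).
[cite: GouveiaRobinsonThomas2013, Ex. 3.6 (p07)] -/
theorem isConvexPolygon_grtPentagon : IsConvexPolygon grtPentagonVertices := by
  intro i j h1 h2
  fin_cases i <;> fin_cases j <;>
    simp [grtPentagonVertices, polygonSlack_apply, Fin.add_def] at h1 h2 ⊢
  norm_num at h1 h2 ⊢

/-- The affinely regular hexagon is a convex hexagon. [cite: GouveiaRobinsonThomas2013, Ex. 3.6 (p07)] -/
theorem isConvexPolygon_affineHexagon : IsConvexPolygon affineHexagonVertices := by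
  intro i j h1 h2
  fin_cases i <;> fin_cases j <;>
    simp [affineHexagonVertices, polygonSlack_apply, Fin.add_def] at h1 h2 ⊢

/-- Psd matrices `c·vvᵀ + wwᵀ` (`c ≥ 0`), the shape of all printed factors of Example 3.6. [folklore] -/
private def gram2 (c : ℝ) (v w : Fin 4 → ℝ) : Matrix (Fin 4) (Fin 4) ℝ :=
  c • vecMulVec v v + vecMulVec w w

/-- `c·vvᵀ + wwᵀ ⪰ 0` for `c ≥ 0`. [folklore] -/
private theorem posSemidef_gram2 {c : ℝ} (hc : 0 ≤ c) (v w : Fin 4 → ℝ) : (gram2 c v w).PosSemidef := by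
  unfold gram2
  refine PosSemidef.add (PosSemidef.smul ?_ hc) ?_
  · simpa using posSemidef_vecMulVec_self_star v
  · simpa using posSemidef_vecMulVec_self_star w

/-- `Tr((c vvᵀ + wwᵀ)(c' ppᵀ + qqᵀ)) = cc'(v·p)² + c(v·q)² + c'(w·p)² + (w·q)²`. [folklore] -/
private theorem trace_gram2_mul (c c' : ℝ) (v w p q : Fin 4 → ℝ) :
    (gram2 c v w * gram2 c' p q).trace =
      c * c' * (v ⬝ᵥ p) ^ 2 + c * (v ⬝ᵥ q) ^ 2 + c' * (w ⬝ᵥ p) ^ 2 + (w ⬝ᵥ q) ^ 2 := by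
  simp only [gram2, Matrix.add_mul, Matrix.mul_add, Matrix.smul_mul, Matrix.mul_smul, trace_add,
    trace_smul, vecMulVec_mul_vecMulVec, trace_vecMulVec, smul_eq_mul, dotProduct_smul]
  ring

/-- **GRT Example 3.6 (i)** (p08, verbatim): "This pentagon has psd rank four due to the
`S^4_+`-factorization given by the following matrices (the first five matrices correspond to the rows
and the second five to the columns)" — the ten printed integer matrices, written as `c·vvᵀ + wwᵀ`:
rows `3e₀e₀ᵀ + (0,1,1,−1)(0,1,1,−1)ᵀ`, `(1,−1,0,0)⊗² + (0,0,1,−1)⊗²`, `(1,0,0,−1)⊗² + (0,1,−1,0)⊗²`,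
`(1,1,0,0)⊗² + (0,0,1,1)⊗²`, `(1,0,0,1)⊗² + (0,1,1,0)⊗²`; columns `(0,0,1,1)⊗²`, `(1,1,1,1)⊗²`,
`(1,−1,−1,1)⊗²`, `(1,−1,1,−1)⊗²`, `(0,1,−1,0)⊗²`. [cite: GouveiaRobinsonThomas2013, Ex. 3.6 (i) (p08)] -/
theorem hasPsdFactorization_grtPentagonSlack_four : HasPsdFactorization grtPentagonSlack 4 := by
  let cA : Fin 5 → ℝ := ![3, 1, 1, 1, 1]
  let vA : Fin 5 → Fin 4 → ℝ := ![![1, 0, 0, 0], ![1, -1, 0, 0], ![1, 0, 0, -1], ![1, 1, 0, 0], ![1, 0, 0, 1]]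
  let wA : Fin 5 → Fin 4 → ℝ := ![![0, 1, 1, -1], ![0, 0, 1, -1], ![0, 1, -1, 0], ![0, 0, 1, 1], ![0, 1, 1, 0]]
  let vB : Fin 5 → Fin 4 → ℝ := ![![0, 0, 1, 1], ![1, 1, 1, 1], ![1, -1, -1, 1], ![1, -1, 1, -1], ![0, 1, -1, 0]]
  refine ⟨fun i => gram2 (cA i) (vA i) (wA i), fun j => gram2 0 0 (vB j),
    fun i => posSemidef_gram2 (by fin_cases i <;> norm_num [cA]) _ _,
    fun j => posSemidef_gram2 le_rfl _ _, fun i j => ?_⟩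
  rw [trace_gram2_mul]
  fin_cases i <;> fin_cases j <;>
    simp [grtPentagonSlack, cA, vA, wA, vB, dotProduct, Fin.sum_univ_four] <;> norm_num

/-- **GRT Example 3.6 (iii)** (p08, verbatim): "A `S^4_+`-factorization of `S_H` is gotten by assigning
the following six psd matrices of rank two to the columns … and the following six psd matrices of rank
one to the rows" — the twelve printed integer matrices, written as `vvᵀ + wwᵀ`: columns
`(1,−1,0,1)⊗² + e₂⊗²`, `e₀⊗² + (0,1,1,−1)⊗²`, `(1,1,1,0)⊗² + e₃⊗²`, `(1,1,0,1)⊗² + e₂⊗²`,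
`e₀⊗² + (0,1,−1,1)⊗²`, `(1,−1,1,0)⊗² + e₃⊗²`; rows `(1,1,0,0)⊗²`, `(0,1,0,1)⊗²`, `(0,1,−1,0)⊗²`,
`(1,−1,0,0)⊗²`, `(0,1,0,−1)⊗²`, `(0,1,1,0)⊗²`. [cite: GouveiaRobinsonThomas2013, Ex. 3.6 (iii) (p08)] -/
theorem hasPsdFactorization_grtHexagonSlack_four : HasPsdFactorization grtHexagonSlack 4 := by
  let vA : Fin 6 → Fin 4 → ℝ := ![![1, 1, 0, 0], ![0, 1, 0, 1], ![0, 1, -1, 0], ![1, -1, 0, 0],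
    ![0, 1, 0, -1], ![0, 1, 1, 0]]
  let vB : Fin 6 → Fin 4 → ℝ := ![![1, -1, 0, 1], ![1, 0, 0, 0], ![1, 1, 1, 0], ![1, 1, 0, 1],
    ![1, 0, 0, 0], ![1, -1, 1, 0]]
  let wB : Fin 6 → Fin 4 → ℝ := ![![0, 0, 1, 0], ![0, 1, 1, -1], ![0, 0, 0, 1], ![0, 0, 1, 0],
    ![0, 1, -1, 1], ![0, 0, 0, 1]]
  refine ⟨fun i => gram2 0 0 (vA i), fun j => gram2 1 (vB j) (wB j),
    fun i => posSemidef_gram2 le_rfl _ _, fun j => posSemidef_gram2 zero_le_one _ _, fun i j => ?_⟩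
  rw [trace_gram2_mul]
  fin_cases i <;> fin_cases j <;>
    simp [grtHexagonSlack, vA, vB, wB, dotProduct, Fin.sum_univ_four] <;> norm_num

/-- **GRT Example 3.6 + Theorem 4.7: `rank_psd S_P = 4` exactly** (p08: "these polytopes have psd rank
at least four which is not the minimum possible in the plane" and "(i) This pentagon has psd rank
four"): the printed factorization of size `4`, and no psd factorization of size `≤ 3` (Theorem 4.7
for the pentagon, transported along the column scaling `grtPentagonSlack_eq`).
[cite: GouveiaRobinsonThomas2013, Ex. 3.6 (i) (p08)] -/
theorem grtPentagonSlack_psdRank :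
    HasPsdFactorization grtPentagonSlack 4 ∧ ∀ k, HasPsdFactorization grtPentagonSlack k → 4 ≤ k := by
  refine ⟨hasPsdFactorization_grtPentagonSlack_four, fun k hk => ?_⟩
  rw [grtPentagonSlack_eq] at hk
  have hk' : HasPsdFactorization (polygonSlack grtPentagonVertices) k :=
    (hasPsdFactorization_rescale_iff (M := fun i j => polygonSlack grtPentagonVertices i j)
      (fun _ => one_pos) (fun j => by fin_cases j <;> norm_num)).mp hk
  exact isConvexPolygon_grtPentagon.four_le_of_hasPsdFactorization (by norm_num) hk'

/-- **GRT Example 3.6 + Theorem 4.7: `rank_psd S_H = 4` exactly** (p08 (iii): "`√rank S_H = 4`. A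
`S^4_+`-factorization of `S_H` is gotten by …", and Theorem 4.7: the hexagon has `≥ 5` vertices).
[cite: GouveiaRobinsonThomas2013, Ex. 3.6 (iii) (p08)] -/
theorem grtHexagonSlack_psdRank :
    HasPsdFactorization grtHexagonSlack 4 ∧ ∀ k, HasPsdFactorization grtHexagonSlack k → 4 ≤ k := by
  refine ⟨hasPsdFactorization_grtHexagonSlack_four, fun k hk => ?_⟩
  rw [grtHexagonSlack_eq] at hk
  have hk' : HasPsdFactorization (polygonSlack affineHexagonVertices) k :=
    (hasPsdFactorization_rescale_iff (M := fun i j => polygonSlack affineHexagonVertices i j)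
      (fun _ => one_pos) (fun _ => two_pos)).mp hk
  exact isConvexPolygon_affineHexagon.four_le_of_hasPsdFactorization (by norm_num) hk'

end Examples


/-! ### Theorem 4.3 and Proposition 3.2 (facet factors) for `V`/`H`-described polytopes -/

section VH

variable {d : ℕ}

/-- **GRT Theorem 4.3** (p10, verbatim): "Any full-dimensional polytope in `ℝⁿ` with `n+2` vertices
has psd rank `n+1`." Typed in the `V`/`H`-description vocabulary of `FawziEtAl2015_cor59`
(`PolytopePsdRankLowerBound.lean`): `n + 2` points `x_i` with `conv{x_i} = {y : a_jᵀy ≤ b_j}` of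
dimension `n ≥ 1`, and every inequality of the description tight at `≥ n` of the points — each facet
of an `n`-polytope contains `≥ n` vertices, which is how the printed proof uses that the columns of
`S_P` are the facets ("Each column of `S_P` must have at least `n` zeros"). Conclusion: the slack
matrix `(b_j − a_jᵀx_i)` has a psd factorization of size `n + 1` and none smaller (Prop. 3.2):
`rank_psd = n + 1`. Proof as printed: `rank S_P = n + 1 < n + 2` gives a left kernel vector, and the
signed square root trick (`hasHadamardSqrtOfRankLE_of_vecMul_eq_zero`) a Hadamard square root of rank
`≤ n + 1`. [cite: GouveiaRobinsonThomas2013, Thm. 4.3 (p10)] -/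
theorem GouveiaRobinsonThomas2013_thm43 {f n : ℕ} (x : Fin (n + 2) → (Fin d → ℝ))
    (a : Fin f → (Fin d → ℝ)) (b : Fin f → ℝ) (hn : 1 ≤ n)
    (hdim : Module.finrank ℝ (vectorSpan ℝ (Set.range x)) = n)
    (hP : convexHull ℝ (Set.range x) = {y | ∀ j, a j ⬝ᵥ y ≤ b j})
    (hfacet : ∀ j, n ≤ (Finset.univ.filter fun i => a j ⬝ᵥ x i = b j).card) :
    HasPsdFactorization (fun i j => b j - a j ⬝ᵥ x i) (n + 1) ∧
      ∀ k, HasPsdFactorization (fun i j => b j - a j ⬝ᵥ x i) k → n + 1 ≤ k := by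
  classical
  refine ⟨?_, fun k hk => add_one_le_of_hasPsdFactorization_slack x a b hP hdim hn hk⟩
  have hrank : (Matrix.of (pairSlackMatrix x a b)).rank = n + 1 :=
    rank_pairSlackMatrix_eq_finrank_add_one x a b hn hdim hP
  have hxP : ∀ i j, a j ⬝ᵥ x i ≤ b j := fun i => by
    have hi : x i ∈ convexHull ℝ (Set.range x) := subset_convexHull ℝ _ (Set.mem_range_self i)
    rw [hP] at hi
    exact hi
  obtain ⟨u, hu, huS⟩ := exists_vecMul_eq_zero_of_rank_lt_card (Matrix.of (pairSlackMatrix x a b))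
    (by rw [hrank]; simp)
  have hcol : ∀ j, (Finset.univ.filter fun i => (Matrix.of (pairSlackMatrix x a b)) i j ≠ 0).card ≤ 2 := by
    intro j
    have h2 : (Finset.univ.filter fun i => (Matrix.of (pairSlackMatrix x a b)) i j ≠ 0) =
        Finset.univ \ (Finset.univ.filter fun i => a j ⬝ᵥ x i = b j) := by
      ext i
      simp [sub_eq_zero, eq_comm]
    rw [h2, Finset.card_sdiff_of_subset (Finset.filter_subset _ _), Finset.card_univ, Fintype.card_fin]
    have := hfacet j
    omega
  have h := hasHadamardSqrtOfRankLE_of_vecMul_eq_zero _ (fun i j => pairSlackMatrix_nonneg hxP i j)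
    hcol hu huS
  simp only [Fintype.card_fin] at h
  exact h.hasPsdFactorization

/-- **GRT Proposition 3.2, second statement, facet factors** (p07, verbatim: "if `rank_psd P = n+1`,
then every `S^{n+1}_+`-factorization of the slack matrix of `P` only uses rank one matrices as
factors"; printed proof for the column of a facet `F`: "By Proposition 2.6 the factor corresponding to
the facet `F` has rank one", the factors of the VERTICES being handled by polarity, not typed here).
Typed for a `V`/`H`-described polytope `conv{x_i} = {y : a_jᵀy ≤ b_j}` of dimension `n ≥ 2` and an
inequality `c` whose tight points span an `(n−1)`-dimensional face (a facet): in every psd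
factorization `b_j − a_jᵀx_i = Tr(A_iB_j)` of size `n + 1`, `rank B_c ≤ 1`. (The rows tight at `c`
form the `V`/`H`-described facet, of psd rank `≥ n` by Prop. 3.2 / Cor. 5.9 for faces with an
equality, `add_one_le_of_hasPsdFactorization_slack_of_eq`; then `rank_colFactor_add_le`.)
[cite: GouveiaRobinsonThomas2013, Prop. 3.2 (p07)] -/
theorem rank_facetFactor_le_one {ι κ : Type*} [Fintype ι] [Fintype κ] (x : ι → (Fin d → ℝ))
    (a : κ → (Fin d → ℝ)) (b : κ → ℝ) (hP : convexHull ℝ (Set.range x) = {y | ∀ j, a j ⬝ᵥ y ≤ b j})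
    {n : ℕ} (hn : 2 ≤ n) (c : κ)
    (hfacet : Module.finrank ℝ (vectorSpan ℝ (Set.range fun i : {i : ι // a c ⬝ᵥ x i = b c} => x i.1)) + 1 = n)
    (A : ι → Matrix (Fin (n + 1)) (Fin (n + 1)) ℝ) (B : κ → Matrix (Fin (n + 1)) (Fin (n + 1)) ℝ)
    (hA : ∀ i, (A i).PosSemidef) (hB : ∀ j, (B j).PosSemidef)
    (hS : ∀ i j, b j - a j ⬝ᵥ x i = (A i * B j).trace) : (B c).rank ≤ 1 := by
  classical
  -- the rows tight at `c`: the facet as a `V`/`H` polytope with one equality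
  have hF' : convexHull ℝ (Set.range fun i : {i : ι // a c ⬝ᵥ x i = b c} => x i.1) =
      {y | (∀ j, a j ⬝ᵥ y ≤ b j) ∧ ∀ _l : Unit, a c ⬝ᵥ y = b c} := by
    rw [convexHull_range_tight_eq x a b hP c]
    ext y
    simp only [Set.mem_setOf_eq, forall_const]
    constructor
    · rintro ⟨h1, h2⟩; exact ⟨h1, le_antisymm (h1 c) h2⟩
    · rintro ⟨h1, h2⟩; exact ⟨h1, h2.symm.le⟩
  have hn1 : Module.finrank ℝ (vectorSpan ℝ (Set.range fun i : {i : ι // a c ⬝ᵥ x i = b c} => x i.1)) =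
      n - 1 := by omega
  have hlow : ∀ k, HasPsdFactorization
      (fun (i : {i : ι // (fun i j => b j - a j ⬝ᵥ x i) i c = 0}) j => b j - a j ⬝ᵥ x i.1) k → n ≤ k := by
    intro k hk
    -- transport to the rows `{i // a c x i = b c}`
    have hk' : HasPsdFactorization
        (fun (i : {i : ι // a c ⬝ᵥ x i = b c}) j => b j - a j ⬝ᵥ x i.1) k :=
      hk.submatrix (fun i : {i : ι // a c ⬝ᵥ x i = b c} =>
        (⟨i.1, sub_eq_zero.mpr i.2.symm⟩ : {i : ι // (fun i j => b j - a j ⬝ᵥ x i) i c = 0})) id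
    have h := add_one_le_of_hasPsdFactorization_slack_of_eq
      (fun i : {i : ι // a c ⬝ᵥ x i = b c} => x i.1) a b (fun _ : Unit => a c) (fun _ => b c) hF'
      hn1 (by omega) hk'
    omega
  have h := rank_colFactor_add_le (M := fun i j => b j - a j ⬝ᵥ x i) A B hA hB hS c hlow
  omega

/-- Convex-hull membership of a finite family as a convex combination with weights on the whole
index type. [folklore] -/
private theorem exists_weights_of_mem_convexHull {ι : Type*} [Fintype ι] {E : Type*} [AddCommGroup E]
    [Module ℝ E] (x : ι → E) {y : E} (hy : y ∈ convexHull ℝ (Set.range x)) :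
    ∃ w : ι → ℝ, (∀ i, 0 ≤ w i) ∧ ∑ i, w i = 1 ∧ ∑ i, w i • x i = y := by
  classical
  rw [convexHull_range_eq_exists_affineCombination] at hy
  obtain ⟨s, w, hw₀, hw₁, rfl⟩ := hy
  refine ⟨fun i => if i ∈ s then w i else 0, fun i => ?_, ?_, ?_⟩
  · by_cases hi : i ∈ s
    · simpa [hi] using hw₀ i hi
    · simp [hi]
  · rw [Finset.sum_ite_mem, Finset.univ_inter, hw₁]
  · rw [Finset.affineCombination_eq_linear_combination s x w hw₁]
    simp only [ite_smul, zero_smul, Finset.sum_ite_mem, Finset.univ_inter]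

/-- **GRT Proposition 3.2, second statement, vertex factors** (p07: "To prove that all factors indexed by
the vertices of `P` also have rank one, recall that the transpose of a slack matrix of `P` is (up to
row scaling) a slack matrix of the polar polytope `P°`"). Typed for a `V`/`H`-described polytope
`conv{x_i} = {y : a_jᵀy ≤ b_j}` of dimension `n ≥ 2` and a point `x_p` that is a VERTEX, i.e.
strictly separated from the other points by a linear functional `c` (`cᵀx_p < cᵀx_i` for `x_i ≠ x_p`):
in every psd factorization `b_j − a_jᵀx_i = Tr(A_iB_j)` of size `n + 1`, `rank A_p ≤ 1`. Instead of
polarity the proof uses the VERTEX FIGURE: the columns tight at `x_p`, restricted to the rows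
`x_i ≠ x_p` and rescaled by `cᵀ(x_i − x_p) > 0`, form the slack matrix of the `(n−1)`-polytope
`conv{x_p + (x_i − x_p)/cᵀ(x_i − x_p)} = {y : a_jᵀy ≤ b_j (j tight at x_p), cᵀy = cᵀx_p + 1}` (the cone
of feasible directions at a vertex is cut out by the tight inequalities), which has psd rank `≥ n`
(Prop. 3.2 for faces with an equality, `add_one_le_of_hasPsdFactorization_slack_of_eq`); then
`rank_rowFactor_add_le`. [cite: GouveiaRobinsonThomas2013, Prop. 3.2 (p07)] -/
theorem rank_vertexFactor_le_one {ι κ : Type*} [Fintype ι] [Fintype κ] (x : ι → (Fin d → ℝ))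
    (a : κ → (Fin d → ℝ)) (b : κ → ℝ) (hP : convexHull ℝ (Set.range x) = {y | ∀ j, a j ⬝ᵥ y ≤ b j})
    {n : ℕ} (hn : 2 ≤ n) (hdim : Module.finrank ℝ (vectorSpan ℝ (Set.range x)) = n) (p : ι)
    (c : Fin d → ℝ) (hc : ∀ i, x i ≠ x p → c ⬝ᵥ x p < c ⬝ᵥ x i)
    (A : ι → Matrix (Fin (n + 1)) (Fin (n + 1)) ℝ) (B : κ → Matrix (Fin (n + 1)) (Fin (n + 1)) ℝ)
    (hA : ∀ i, (A i).PosSemidef) (hB : ∀ j, (B j).PosSemidef)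
    (hS : ∀ i j, b j - a j ⬝ᵥ x i = (A i * B j).trace) : (A p).rank ≤ 1 := by
  classical
  have hxP : ∀ i j, a j ⬝ᵥ x i ≤ b j := fun i => by
    have hi : x i ∈ convexHull ℝ (Set.range x) := subset_convexHull ℝ _ (Set.mem_range_self i)
    rw [hP] at hi
    exact hi
  -- the separating values `ℓ_i = cᵀ(x_i − x_p) > 0`
  let ℓ : ι → ℝ := fun i => c ⬝ᵥ (x i - x p)
  have hℓ : ∀ i : {i : ι // x i ≠ x p}, 0 < ℓ i.1 := fun i => by
    have := hc i.1 i.2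
    simp only [ℓ, dotProduct_sub]; linarith
  -- the vertex figure points `y_i = x_p + (x_i − x_p)/ℓ_i`
  let y : {i : ι // x i ≠ x p} → (Fin d → ℝ) := fun i => x p + (ℓ i.1)⁻¹ • (x i.1 - x p)
  have hcy : ∀ i, c ⬝ᵥ y i = c ⬝ᵥ x p + 1 := fun i => by
    simp only [y, dotProduct_add, dotProduct_smul, smul_eq_mul]
    rw [show c ⬝ᵥ (x i.1 - x p) = ℓ i.1 from rfl, inv_mul_cancel₀ (hℓ i).ne']
  have hslack : ∀ (i : {i : ι // x i ≠ x p}) (j : {j : κ // a j ⬝ᵥ x p = b j}),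
      b j.1 - a j.1 ⬝ᵥ y i = (ℓ i.1)⁻¹ * (b j.1 - a j.1 ⬝ᵥ x i.1) := fun i j => by
    simp only [y, dotProduct_add, dotProduct_smul, smul_eq_mul, dotProduct_sub]
    rw [j.2]; ring
  -- the `H`-description of the vertex figure
  have hQ : convexHull ℝ (Set.range y) =
      {z | (∀ j : {j : κ // a j ⬝ᵥ x p = b j}, a j.1 ⬝ᵥ z ≤ b j.1) ∧ ∀ _l : Unit, c ⬝ᵥ z = c ⬝ᵥ x p + 1} := by
    apply Set.Subset.antisymm
    · refine convexHull_min ?_ ?_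
      · rintro _ ⟨i, rfl⟩
        refine ⟨fun j => ?_, fun _ => hcy i⟩
        have h := hslack i j
        have h2 : 0 ≤ (ℓ i.1)⁻¹ * (b j.1 - a j.1 ⬝ᵥ x i.1) :=
          mul_nonneg (inv_nonneg.mpr (hℓ i).le) (sub_nonneg.mpr (hxP _ _))
        linarith
      · intro z₁ hz₁ z₂ hz₂ α β hα hβ hαβ
        refine ⟨fun j => ?_, fun _ => ?_⟩
        · have h₁ := hz₁.1 j; have h₂ := hz₂.1 j
          rw [dotProduct_add, dotProduct_smul, dotProduct_smul, smul_eq_mul, smul_eq_mul]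
          calc α * (a j.1 ⬝ᵥ z₁) + β * (a j.1 ⬝ᵥ z₂) ≤ α * b j.1 + β * b j.1 :=
                add_le_add (mul_le_mul_of_nonneg_left h₁ hα) (mul_le_mul_of_nonneg_left h₂ hβ)
            _ = b j.1 := by rw [← add_mul, hαβ, one_mul]
        · have h₁ := hz₁.2 (); have h₂ := hz₂.2 ()
          rw [dotProduct_add, dotProduct_smul, dotProduct_smul, smul_eq_mul, smul_eq_mul, h₁, h₂,
            ← add_mul, hαβ, one_mul]
    · rintro z ⟨hzT, hzc⟩
      have hzc' : c ⬝ᵥ (z - x p) = 1 := by rw [dotProduct_sub, hzc ()]; ring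
      -- a small step from `x_p` towards `z` stays in `P`
      have hstep : ∀ᶠ t in nhdsWithin (0 : ℝ) (Set.Ioi 0), ∀ j, a j ⬝ᵥ (x p + t • (z - x p)) ≤ b j := by
        rw [Filter.eventually_all]
        intro j
        by_cases hj : a j ⬝ᵥ x p = b j
        · filter_upwards [self_mem_nhdsWithin] with t ht
          have hz := hzT ⟨j, hj⟩
          rw [dotProduct_add, dotProduct_smul, smul_eq_mul, hj, dotProduct_sub]
          nlinarith [(show (0:ℝ) < t from ht).le]
        · have hslt : a j ⬝ᵥ x p < b j := lt_of_le_of_ne (hxP p j) hj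
          have ht : Filter.Tendsto (fun t : ℝ => a j ⬝ᵥ x p + t * (a j ⬝ᵥ (z - x p)))
              (nhdsWithin (0 : ℝ) (Set.Ioi 0)) (nhds (a j ⬝ᵥ x p + 0 * (a j ⬝ᵥ (z - x p)))) :=
            tendsto_nhdsWithin_of_tendsto_nhds
              ((continuous_const.add (continuous_id.mul continuous_const)).tendsto 0)
          rw [zero_mul, add_zero] at ht
          filter_upwards [ht.eventually (gt_mem_nhds hslt)] with t ht'
          rw [dotProduct_add, dotProduct_smul, smul_eq_mul]
          exact ht'.le
      obtain ⟨t, ht, ht0⟩ := (hstep.and self_mem_nhdsWithin).exists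
      have ht0 : (0 : ℝ) < t := ht0
      -- `w = x_p + t (z − x_p) ∈ P = conv{x_i}`
      have hw : x p + t • (z - x p) ∈ convexHull ℝ (Set.range x) := by rw [hP]; exact ht
      obtain ⟨μ, hμ0, hμ1, hμw⟩ := exists_weights_of_mem_convexHull x hw
      -- `Σ μ_i (x_i − x_p) = t (z − x_p)`
      have hsum : ∑ i, μ i • (x i - x p) = t • (z - x p) := by
        have : ∑ i, μ i • (x i - x p) = ∑ i, μ i • x i - (∑ i, μ i) • x p := by
          rw [Finset.sum_smul, ← Finset.sum_sub_distrib]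
          refine Finset.sum_congr rfl fun i _ => by rw [smul_sub]
        rw [this, hμw, hμ1, one_smul, add_sub_cancel_left]
      -- only the rows `x_i ≠ x_p` contribute
      have hsum' : ∑ i : {i : ι // x i ≠ x p}, μ i.1 • (x i.1 - x p) = t • (z - x p) := by
        have hzero : ∑ i : {i : ι // ¬ (x i ≠ x p)}, μ i.1 • (x i.1 - x p) = 0 :=
          Finset.sum_eq_zero fun i _ => by
            have : x i.1 = x p := by simpa using i.2
            rw [this, sub_self, smul_zero]
        rw [← hsum, ← Fintype.sum_subtype_add_sum_subtype (fun i => x i ≠ x p) (fun i => μ i • (x i - x p)),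
          hzero, add_zero]
      -- the weights `ν_i = μ_i ℓ_i / t`
      let ν : {i : ι // x i ≠ x p} → ℝ := fun i => μ i.1 * ℓ i.1 / t
      have hν0 : ∀ i, 0 ≤ ν i := fun i => div_nonneg (mul_nonneg (hμ0 _) (hℓ i).le) ht0.le
      have hνsum : ∑ i, ν i = 1 := by
        -- apply `c` to `hsum'`
        have h := congrArg (fun v => c ⬝ᵥ v) hsum'
        simp only [dotProduct_sum, dotProduct_smul, smul_eq_mul, hzc', mul_one] at h
        simp only [ν]
        rw [← Finset.sum_div, h, div_self ht0.ne']
      have hνy : ∑ i, ν i • y i = z := by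
        have e : ∀ i : {i : ι // x i ≠ x p}, ν i • y i = ν i • x p + t⁻¹ • (μ i.1 • (x i.1 - x p)) := by
          intro i
          simp only [y, ν, smul_add, smul_smul]
          congr 1
          rw [show μ i.1 * ℓ i.1 / t * (ℓ i.1)⁻¹ = t⁻¹ * μ i.1 by field_simp [(hℓ i).ne', ht0.ne']]
        rw [Finset.sum_congr rfl fun i _ => e i, Finset.sum_add_distrib, ← Finset.sum_smul, hνsum,
          one_smul, ← Finset.smul_sum, hsum', smul_smul, inv_mul_cancel₀ ht0.ne', one_smul,
          add_sub_cancel]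
      rw [← hνy]
      exact (convex_convexHull ℝ _).sum_mem (fun i _ => hν0 i) hνsum
        fun i _ => subset_convexHull ℝ _ (Set.mem_range_self i)
  -- dimension of the vertex figure: `n ≤ dim + 1`
  have hdimQ : n ≤ Module.finrank ℝ (vectorSpan ℝ (Set.range y)) + 1 := by
    -- a point different from `x_p` exists
    have hne : ∃ i, x i ≠ x p := by
      by_contra h
      push Not at h
      have hr : Set.range x = {x p} := by
        ext v; simp only [Set.mem_range, Set.mem_singleton_iff]
        exact ⟨fun ⟨i, hi⟩ => hi ▸ h i, fun hv => ⟨p, hv.symm⟩⟩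
      rw [hr, vectorSpan_singleton, finrank_bot] at hdim
      omega
    obtain ⟨i0, hi0⟩ := hne
    let I0 : {i : ι // x i ≠ x p} := ⟨i0, hi0⟩
    have hV : vectorSpan ℝ (Set.range x) ≤
        (ℝ ∙ (y I0 - x p)) ⊔ vectorSpan ℝ (Set.range y) := by
      rw [vectorSpan_range_eq_span_range_vsub_right ℝ x p, Submodule.span_le]
      rintro _ ⟨i, rfl⟩
      simp only [vsub_eq_sub, SetLike.mem_coe]
      by_cases hi : x i = x p
      · rw [hi, sub_self]; exact Submodule.zero_mem _
      · -- `x_i − x_p = ℓ_i • (y_i − x_p) = ℓ_i • ((y_i − y_{i0}) + (y_{i0} − x_p))`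
        have e : x i - x p = ℓ i • ((y ⟨i, hi⟩ - y I0) + (y I0 - x p)) := by
          have : y ⟨i, hi⟩ - x p = (ℓ i)⁻¹ • (x i - x p) := by simp only [y]; abel
          rw [sub_add_sub_cancel, this, smul_smul, mul_inv_cancel₀ (hℓ ⟨i, hi⟩).ne', one_smul]
        rw [e]
        refine Submodule.smul_mem _ _ (Submodule.add_mem _ ?_ ?_)
        · exact Submodule.mem_sup_right (vsub_mem_vectorSpan ℝ (Set.mem_range_self _) (Set.mem_range_self _))
        · exact Submodule.mem_sup_left (Submodule.mem_span_singleton_self _)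
    have h1 : Module.finrank ℝ (ℝ ∙ (y I0 - x p)) ≤ 1 := by
      have := finrank_span_le_card (R := ℝ) ({y I0 - x p} : Set (Fin d → ℝ))
      simpa using this
    have h2 := Submodule.finrank_mono hV
    have h3 := Submodule.finrank_add_le_finrank_add_finrank (ℝ ∙ (y I0 - x p)) (vectorSpan ℝ (Set.range y))
    omega
  -- the row bound
  have h := rank_rowFactor_add_le (M := fun i j => b j - a j ⬝ᵥ x i) A B hA hB hS p (n := n) fun k hk => by
    -- restrict to the rows `x_i ≠ x_p`, reindex the tight columns, rescale the rows by `ℓ_i⁻¹`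
    have hk1 : HasPsdFactorization
        (fun (i : {i : ι // x i ≠ x p}) (j : {j : κ // a j ⬝ᵥ x p = b j}) => b j.1 - a j.1 ⬝ᵥ x i.1) k :=
      hk.submatrix (fun i : {i : ι // x i ≠ x p} => i.1)
        (fun j : {j : κ // a j ⬝ᵥ x p = b j} =>
          (⟨j.1, sub_eq_zero.mpr j.2.symm⟩ : {j : κ // (fun i j => b j - a j ⬝ᵥ x i) p j = 0}))
    have hk2 : HasPsdFactorization
        (fun (i : {i : ι // x i ≠ x p}) (j : {j : κ // a j ⬝ᵥ x p = b j}) => b j.1 - a j.1 ⬝ᵥ y i) k := by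
      have h := hk1.rescale (c := fun i => (ℓ i.1)⁻¹) (d := fun _ => 1)
        (fun i => inv_nonneg.mpr (hℓ i).le) (fun _ => zero_le_one)
      have e : (fun (i : {i : ι // x i ≠ x p}) (j : {j : κ // a j ⬝ᵥ x p = b j}) => b j.1 - a j.1 ⬝ᵥ y i) =
          fun i j => (ℓ i.1)⁻¹ * (b j.1 - a j.1 ⬝ᵥ x i.1) * 1 := by
        funext i j; rw [hslack, mul_one]
      rw [e]; exact h
    have := add_one_le_of_hasPsdFactorization_slack_of_eq y (fun j : {j : κ // a j ⬝ᵥ x p = b j} => a j.1)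
      (fun j => b j.1) (fun _ : Unit => c) (fun _ => c ⬝ᵥ x p + 1) hQ rfl (by omega) hk2
    omega
  omega

/-- **GRT Proposition 3.2, second statement** (p07, verbatim): "if `rank_psd P = n+1`, then every
`S^{n+1}_+`-factorization of the slack matrix of `P` only uses rank one matrices as factors." Typed
for the slack matrix `S_P` proper of a `V`/`H`-described `n`-polytope, `n ≥ 2`: rows = vertices (each
`x_p` strictly separated from the other points by a linear functional), columns = facets (each
inequality tight on an `(n−1)`-dimensional set of points); then all factors of a
`S^{n+1}_+`-factorization have rank `≤ 1` (`rank_vertexFactor_le_one`, `rank_facetFactor_le_one`).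
[cite: GouveiaRobinsonThomas2013, Prop. 3.2 (p07)] -/
theorem GouveiaRobinsonThomas2013_prop32_rankOne {ι κ : Type*} [Fintype ι] [Fintype κ]
    (x : ι → (Fin d → ℝ)) (a : κ → (Fin d → ℝ)) (b : κ → ℝ)
    (hP : convexHull ℝ (Set.range x) = {y | ∀ j, a j ⬝ᵥ y ≤ b j})
    {n : ℕ} (hn : 2 ≤ n) (hdim : Module.finrank ℝ (vectorSpan ℝ (Set.range x)) = n)
    (hvert : ∀ p, ∃ c : Fin d → ℝ, ∀ i, x i ≠ x p → c ⬝ᵥ x p < c ⬝ᵥ x i)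
    (hfacet : ∀ j, Module.finrank ℝ
      (vectorSpan ℝ (Set.range fun i : {i : ι // a j ⬝ᵥ x i = b j} => x i.1)) + 1 = n)
    (A : ι → Matrix (Fin (n + 1)) (Fin (n + 1)) ℝ) (B : κ → Matrix (Fin (n + 1)) (Fin (n + 1)) ℝ)
    (hA : ∀ i, (A i).PosSemidef) (hB : ∀ j, (B j).PosSemidef)
    (hS : ∀ i j, b j - a j ⬝ᵥ x i = (A i * B j).trace) :
    (∀ i, (A i).rank ≤ 1) ∧ ∀ j, (B j).rank ≤ 1 :=
  ⟨fun i => by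
    obtain ⟨c, hc⟩ := hvert i
    exact rank_vertexFactor_le_one x a b hP hn hdim i c hc A B hA hB hS,
   fun j => rank_facetFactor_le_one x a b hP hn j (hfacet j) A B hA hB hS⟩

/-- **GRT Theorem 3.5** (p07, verbatim): "If `P ⊂ ℝⁿ` is a full-dimensional polytope, then
`rank_psd P = n+1` if and only if `rank_√ S_P = n+1`." Typed for `S_P` as in
`GouveiaRobinsonThomas2013_prop32_rankOne` (vertex rows, facet columns, `n ≥ 2`): `S_P` has a psd
factorization of size `n + 1` iff it has a Hadamard square root of rank `≤ n + 1` (`⇐` Prop. 2.2 = FGPRT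
Cor. 5.3; `⇒` Prop. 3.2 gives rank-one factors and Lemma 2.4 = FGPRT Prop. 6.2 a square root); with
Prop. 3.2 / Cor. 5.9 (`rank_psd, rank_√ ≥ n + 1` always) this is the printed equivalence.
[cite: GouveiaRobinsonThomas2013, Thm. 3.5 (p07)] -/
theorem GouveiaRobinsonThomas2013_thm35 {ι κ : Type*} [Fintype ι] [Fintype κ]
    (x : ι → (Fin d → ℝ)) (a : κ → (Fin d → ℝ)) (b : κ → ℝ)
    (hP : convexHull ℝ (Set.range x) = {y | ∀ j, a j ⬝ᵥ y ≤ b j})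
    {n : ℕ} (hn : 2 ≤ n) (hdim : Module.finrank ℝ (vectorSpan ℝ (Set.range x)) = n)
    (hvert : ∀ p, ∃ c : Fin d → ℝ, ∀ i, x i ≠ x p → c ⬝ᵥ x p < c ⬝ᵥ x i)
    (hfacet : ∀ j, Module.finrank ℝ
      (vectorSpan ℝ (Set.range fun i : {i : ι // a j ⬝ᵥ x i = b j} => x i.1)) + 1 = n) :
    HasPsdFactorization (fun i j => b j - a j ⬝ᵥ x i) (n + 1) ↔
      HasHadamardSqrtOfRankLE (Matrix.of fun i j => b j - a j ⬝ᵥ x i) (n + 1) := by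
  classical
  refine ⟨fun h => ?_, fun h => h.hasPsdFactorization⟩
  obtain ⟨A, B, hA, hB, hS⟩ := h
  obtain ⟨hAr, hBr⟩ := GouveiaRobinsonThomas2013_prop32_rankOne x a b hP hn hdim hvert hfacet A B hA hB hS
  -- `Fintype` index types need not be in `Type`: transport to `Fin` enumerations for `prop62`
  let eι := Fintype.equivFin ι
  let eκ := Fintype.equivFin κ
  have h62 := FawziEtAl2015_prop62_holds (Fin (Fintype.card ι)) (Fin (Fintype.card κ))
    (Matrix.of fun i j => b (eκ.symm j) - a (eκ.symm j) ⬝ᵥ x (eι.symm i)) (n + 1)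
    ⟨fun i => A (eι.symm i), fun j => B (eκ.symm j), fun i => ⟨hA _, hAr _⟩, fun j => ⟨hB _, hBr _⟩,
      fun i j => by simp only [Matrix.of_apply]; exact hS _ _⟩
  obtain ⟨N, hN, hNr⟩ := h62
  refine ⟨N.submatrix eι eκ, fun i j => ?_, ?_⟩
  · have := hN (eι i) (eκ j)
    simp only [Matrix.of_apply, Equiv.symm_apply_apply] at this
    simpa [Matrix.submatrix_apply] using this
  · simpa [Matrix.rank_submatrix] using hNr

end VH

/-! ### Proposition 3.7 (pyramids), matrix form -/

/-- **GRT Proposition 3.7** (p08–p09, verbatim): "If `P ⊂ ℝⁿ` is an `n`-dimensional pyramid over a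
`(n−1)`-polytope `Q` and `rank_psd Q = k`, then `rank_psd P = k+1`." The printed proof exhibits a slack
matrix of `P` of the block form `[S_Q 0; 0 α]`, `α > 0` (apex row, base-facet column), and applies
Prop. 2.6. Typed is that matrix statement: for `α ≠ 0`, `[S 0; 0 α]` has a psd factorization of size
`k + 1` iff `S` has one of size `k` (`⇐` block-diagonal padding, the tree's
`HasPsdFactorization.fromBlocks_diag`; `⇒` FGPRT Thm. 2.10, `FawziEtAl2015_thm210_holds`). The pyramid's
`V`/`H` description itself is not constructed here. [cite: GouveiaRobinsonThomas2013, Prop. 3.7 (p08–p09)] -/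
theorem GouveiaRobinsonThomas2013_prop37_matrix {ι κ : Type} [Finite ι] [Finite κ] (S : ι → κ → ℝ)
    (α : ℝ) (hα : 0 < α) (k : ℕ) :
    HasPsdFactorization (Matrix.fromBlocks (Matrix.of S) 0 0 (Matrix.of fun (_ : Unit) (_ : Unit) => α))
      (k + 1) ↔ HasPsdFactorization S k := by
  constructor
  · intro h
    have e : Matrix.fromBlocks (Matrix.of S) 0 0 (Matrix.of fun (_ : Unit) (_ : Unit) => α) =
        Matrix.fromBlocks (Matrix.of S) 0 (Matrix.of fun (_ : Unit) (_ : κ) => (0 : ℝ))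
          (Matrix.of fun (_ : Unit) (_ : Unit) => α) := by
      ext (i | i) (j | j) <;> rfl
    rw [e] at h
    obtain ⟨k₁, k₂, hk, h₁, h₂⟩ := FawziEtAl2015_thm210_holds ι Unit κ Unit S (fun _ _ => 0)
      (fun _ _ => α) (k + 1) h
    have hk₂ : 1 ≤ k₂ := by
      by_contra h0
      obtain rfl : k₂ = 0 := by omega
      exact hα.ne' (hasPsdFactorization_zero_iff.mp h₂ () ())
    exact h₁.mono (by omega)
  · intro h
    have h1 : HasPsdFactorization (fun (_ : Unit) (_ : Unit) => α) 1 :=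
      ⟨fun _ => α • (1 : Matrix (Fin 1) (Fin 1) ℝ), fun _ => 1, fun _ => PosSemidef.one.smul hα.le,
        fun _ => PosSemidef.one, fun _ _ => by simp⟩
    simpa using h.fromBlocks_diag h1


/-! ### The `H`-description of a convex polygon and Theorem 4.7 as a statement on psd LIFTS -/

section PolygonGeometry

variable {m : ℕ} [NeZero m]

/-- The (inner) normal data of the edge `[x_j, x_{j+1}]`: `a_j = (d₁, −d₀)` for `d = x_{j+1} − x_j`, so
that `b_j − a_jᵀy = det(x_{j+1} − x_j, y − x_j)`. [cite: GouveiaRobinsonThomas2013, Lemma 3.1 (p07)] -/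
def polygonNormal (x : Fin m → (Fin 2 → ℝ)) (j : Fin m) : Fin 2 → ℝ :=
  ![x (j + 1) 1 - x j 1, -(x (j + 1) 0 - x j 0)]

/-- The right-hand side `b_j = a_jᵀ x_j` of the edge inequality `a_jᵀ y ≤ b_j`.
[cite: GouveiaRobinsonThomas2013, Lemma 3.1 (p07)] -/
def polygonOffset (x : Fin m → (Fin 2 → ℝ)) (j : Fin m) : ℝ := polygonNormal x j ⬝ᵥ x j

/-- The edge inequality's slack at `y` is the cross product `det(x_{j+1} − x_j, y − x_j)`.
[cite: GouveiaRobinsonThomas2013, Lemma 3.1 (p07)] -/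
theorem polygonOffset_sub_dotProduct (x : Fin m → (Fin 2 → ℝ)) (j : Fin m) (y : Fin 2 → ℝ) :
    polygonOffset x j - polygonNormal x j ⬝ᵥ y = cross2 (x (j + 1) - x j) (y - x j) := by
  simp [polygonOffset, polygonNormal, cross2, dotProduct, Fin.sum_univ_two]
  ring

/-- The vertex/edge slack matrix IS the slack matrix `(b_j − a_jᵀx_i)` of this `V`/`H` data.
[cite: GouveiaRobinsonThomas2013, Lemma 3.1 (p07)] -/
theorem pairSlackMatrix_polygon (x : Fin m → (Fin 2 → ℝ)) :
    pairSlackMatrix x (polygonNormal x) (polygonOffset x) = fun i j => polygonSlack x i j := by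
  funext i j
  rw [pairSlackMatrix_apply, polygonOffset_sub_dotProduct]
  rfl

/-- Cramer's rule in the plane: `w = (det(w,v)/D)·u + (det(u,w)/D)·v` for `D = det(u,v) ≠ 0`. [folklore] -/
private theorem cramer_two (u v w : Fin 2 → ℝ) (hD : cross2 u v ≠ 0) :
    w = (cross2 w v / cross2 u v) • u + (cross2 u w / cross2 u v) • v := by
  have key : cross2 u v • w = cross2 w v • u + cross2 u w • v := by
    funext t; fin_cases t <;> simp [cross2, smul_eq_mul] <;> ring
  calc w = (cross2 u v)⁻¹ • (cross2 u v • w) := by rw [smul_smul, inv_mul_cancel₀ hD, one_smul]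
    _ = (cross2 w v / cross2 u v) • u + (cross2 u w / cross2 u v) • v := by
      rw [key, smul_add, smul_smul, smul_smul, div_eq_inv_mul, div_eq_inv_mul]

omit [NeZero m] in
/-- Index bookkeeping. [folklore] -/
private theorem idx_val {t : ℕ} (ht : t < m) : (idx t ht : Fin m).val = t := rfl

/-- **The `H`-description of a convex polygon** (GRT p02/p07: the facets of a polytope cut it out; for
a convex polygon with vertices `x₀,…,x_{m−1}` in cyclic order, `P = conv{x_i} = {y : det(x_{j+1} − x_j,
y − x_j) ≥ 0 ∀ j}`). Proof: `⊆` by convexity of half-planes; `⊇` by the fan triangulation from `x₀` —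
for `y` in all edge half-planes, `s_t = det(x_t − x₀, y − x₀)` has `s₁ ≥ 0 ≥ s_{m−1}`, so some
`1 ≤ j ≤ m−2` has `s_j ≥ 0 ≥ s_{j+1}`, and with the `j`-th edge inequality the Cramer coordinates put
`y` in the triangle `x₀ x_j x_{j+1}`. [cite: GouveiaRobinsonThomas2013, Lemma 3.1 (p07, "facet
inequalities of P")] -/
theorem IsConvexPolygon.convexHull_eq {x : Fin m → (Fin 2 → ℝ)} (hx : IsConvexPolygon x) (hm : 3 ≤ m) :
    convexHull ℝ (Set.range x) = {y | ∀ j, polygonNormal x j ⬝ᵥ y ≤ polygonOffset x j} := by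
  classical
  apply Set.Subset.antisymm
  · refine convexHull_min ?_ ?_
    · rintro _ ⟨i, rfl⟩ j
      have h := hx.nonneg i j
      rw [← sub_nonneg, polygonOffset_sub_dotProduct]
      exact h
    · intro y₁ hy₁ y₂ hy₂ α β hα hβ hαβ j
      have h₁ := hy₁ j; have h₂ := hy₂ j
      rw [dotProduct_add, dotProduct_smul, dotProduct_smul, smul_eq_mul, smul_eq_mul]
      calc α * (polygonNormal x j ⬝ᵥ y₁) + β * (polygonNormal x j ⬝ᵥ y₂)
          ≤ α * polygonOffset x j + β * polygonOffset x j :=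
            add_le_add (mul_le_mul_of_nonneg_left h₁ hα) (mul_le_mul_of_nonneg_left h₂ hβ)
        _ = polygonOffset x j := by rw [← add_mul, hαβ, one_mul]
  · intro y hy
    -- edge slacks at `y`
    have hedge : ∀ j : Fin m, 0 ≤ cross2 (x (j + 1) - x j) (y - x j) := fun j => by
      rw [← polygonOffset_sub_dotProduct]; exact sub_nonneg.mpr (hy j)
    have h0 : (0:ℕ) < m := by omega
    -- `s t = det(x_t − x₀, y − x₀)`
    let s : ℕ → ℝ := fun t => if ht : t < m then cross2 (x (idx t ht) - x (idx 0 h0)) (y - x (idx 0 h0)) else 0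
    have hs : ∀ t (ht : t < m), s t = cross2 (x (idx t ht) - x (idx 0 h0)) (y - x (idx 0 h0)) :=
      fun t ht => by simp [s, ht]
    have hs1 : 0 ≤ s 1 := by
      rw [hs 1 (by omega), ← idx_succ (by omega)]
      exact hedge _
    have hsm : s (m - 1) ≤ 0 := by
      have hlast : (idx (m - 1) (by omega) + 1 : Fin m) = idx 0 h0 := by
        apply Fin.ext
        rw [Fin.val_add, Fin.val_one', idx_val, idx_val, Nat.add_mod_mod,
          show m - 1 + 1 = m by omega, Nat.mod_self]
      have h := hedge (idx (m - 1) (by omega))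
      rw [hlast] at h
      rw [hs (m - 1) (by omega)]
      -- det(x₀ − x_{m−1}, y − x_{m−1}) = −det(x_{m−1} − x₀, y − x₀)
      have e : cross2 (x (idx 0 h0) - x (idx (m - 1) (by omega))) (y - x (idx (m - 1) (by omega))) =
          -cross2 (x (idx (m - 1) (by omega)) - x (idx 0 h0)) (y - x (idx 0 h0)) := by
        simp only [cross2, Pi.sub_apply]; ring
      linarith
    -- first `t ≥ 1` with `s (t+1) ≤ 0`
    have hex : ∃ t, 1 ≤ t ∧ s (t + 1) ≤ 0 := ⟨m - 2, by omega, by rwa [show m - 2 + 1 = m - 1 by omega]⟩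
    let j := Nat.find hex
    have hj1 : 1 ≤ j := (Nat.find_spec hex).1
    have hjs : s (j + 1) ≤ 0 := (Nat.find_spec hex).2
    have hjm : j ≤ m - 2 := Nat.find_min' hex ⟨by omega, by rwa [show m - 2 + 1 = m - 1 by omega]⟩
    have hsj : 0 ≤ s j := by
      rcases Nat.eq_or_lt_of_le hj1 with h | h
      · rw [← h]; exact hs1
      · have hmin := Nat.find_min hex (show j - 1 < j by omega)
        push Not at hmin
        have := hmin (by omega)
        rw [show j - 1 + 1 = j by omega] at this
        exact this.le
    have hjlt : j < m := by omega
    have hj1lt : j + 1 < m := by omega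
    -- vectors `u = x_j − x₀`, `v = x_{j+1} − x₀`, `w = y − x₀`; `D = det(u,v) = S(x₀, e_j) > 0`
    set x0 := x (idx 0 h0) with hx0
    set u := x (idx j hjlt) - x0 with hu
    set v := x (idx (j + 1) hj1lt) - x0 with hv
    set w := y - x0 with hw
    have hD : 0 < cross2 u v := by
      have h := hx (idx 0 h0) (idx j hjlt) (idx_ne h0 hjlt (by omega))
        (by rw [idx_succ hj1lt]; exact idx_ne h0 hj1lt (by omega))
      rw [polygonSlack, Matrix.of_apply, idx_succ hj1lt] at h
      have e : cross2 (x (idx (j + 1) hj1lt) - x (idx j hjlt)) (x (idx 0 h0) - x (idx j hjlt)) = cross2 u v := by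
        simp only [hu, hv, hx0, cross2, Pi.sub_apply]; ring
      linarith
    have hsj' : s j = cross2 u w := by rw [hs j hjlt]
    have hsj1' : s (j + 1) = cross2 v w := by rw [hs (j + 1) hj1lt]
    -- Cramer coordinates
    set lam := cross2 w v / cross2 u v with hlam
    set mu := cross2 u w / cross2 u v with hmu
    have hwdec : w = lam • u + mu • v := cramer_two u v w hD.ne'
    have hlam0 : 0 ≤ lam := by
      rw [hlam]; refine div_nonneg ?_ hD.le
      have : cross2 w v = -cross2 v w := by simp only [cross2]; ring
      rw [this]; linarith [hsj1'.symm.le.trans hjs]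
    have hmu0 : 0 ≤ mu := by
      rw [hmu]; exact div_nonneg (by linarith [hsj']) hD.le
    have hsum : lam + mu ≤ 1 := by
      -- the `j`-th edge inequality: det(v − u, w − u) = D (1 − lam − mu) ≥ 0
      have h := hedge (idx j hjlt)
      rw [idx_succ hj1lt] at h
      have e1 : cross2 (x (idx (j + 1) hj1lt) - x (idx j hjlt)) (y - x (idx j hjlt)) = cross2 (v - u) (w - u) := by
        simp only [hu, hv, hw, hx0, cross2, Pi.sub_apply]; ring
      rw [e1, hwdec] at h
      have e2 : cross2 (v - u) (lam • u + mu • v - u) = cross2 u v * (1 - lam - mu) := by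
        simp only [cross2, Pi.sub_apply, Pi.add_apply, Pi.smul_apply, smul_eq_mul]; ring
      rw [e2] at h
      nlinarith
    -- `y = (1 − lam − mu) x₀ + lam x_j + mu x_{j+1}`
    have hy_eq : y = (1 - lam - mu) • x0 + lam • x (idx j hjlt) + mu • x (idx (j + 1) hj1lt) := by
      have : y = x0 + w := by rw [hw]; abel
      rw [this, hwdec, hu, hv]
      funext t
      simp only [Pi.add_apply, Pi.smul_apply, Pi.sub_apply, smul_eq_mul]
      ring
    rw [hy_eq]
    have hx0m : x0 ∈ convexHull ℝ (Set.range x) := subset_convexHull ℝ _ ⟨idx 0 h0, rfl⟩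
    have hxjm : x (idx j hjlt) ∈ convexHull ℝ (Set.range x) := subset_convexHull ℝ _ ⟨_, rfl⟩
    have hxj1m : x (idx (j + 1) hj1lt) ∈ convexHull ℝ (Set.range x) := subset_convexHull ℝ _ ⟨_, rfl⟩
    have hconv := (convex_convexHull ℝ (Set.range x)).sum_mem (t := Finset.univ)
      (w := ![1 - lam - mu, lam, mu]) (z := ![x0, x (idx j hjlt), x (idx (j + 1) hj1lt)])
      (by intro i _; fin_cases i <;> simp <;> linarith) (by simp [Fin.sum_univ_three]; ring)
      (by intro i _; fin_cases i <;> simp [hx0m, hxjm, hxj1m])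
    simpa [Fin.sum_univ_three] using hconv

/-- **FGPRT Theorem 3.3 for polygons**: for a convex `m`-gon `P = conv{x_i}` (`m ≥ 3`) and `k ≥ 1`,
`P` has a psd lift of size `k` (`P = π(S^k_+ ∩ L)`) iff the vertex/edge slack matrix has a psd
factorization of size `k` (the tree's `FawziEtAl2015_thm33_holds` on the `H`-description
`IsConvexPolygon.convexHull_eq`). [cite: FawziEtAl2015, Thm. 3.3 (p09–p10)] -/
theorem IsConvexPolygon.hasPsdLift_iff {x : Fin m → (Fin 2 → ℝ)} (hx : IsConvexPolygon x) (hm : 3 ≤ m)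
    {k : ℕ} (hk : 1 ≤ k) :
    HasPsdLift (convexHull ℝ (Set.range x)) k ↔ HasPsdFactorization (polygonSlack x) k := by
  have h := FawziEtAl2015_thm33_holds 2 m m k x (polygonNormal x) (polygonOffset x) hk (hx.convexHull_eq hm)
  rw [pairSlackMatrix_polygon] at h
  exact h.symm

/-- A set with a psd lift of size `0` is a subsingleton (`S^0_+` is a point). [folklore] -/
private theorem subsingleton_of_hasPsdLift_zero {E : Type*} [AddCommGroup E] [Module ℝ E] {C : Set E}
    (h : HasPsdLift C 0) : C.Subsingleton := by
  obtain ⟨L, π, rfl⟩ := h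
  exact Set.subsingleton_of_subsingleton.image _

/-- A convex polygon has two distinct vertices (so no psd lift of size `0`). [folklore] -/
private theorem IsConvexPolygon.not_hasPsdLift_zero {x : Fin m → (Fin 2 → ℝ)} (hx : IsConvexPolygon x)
    (hm : 3 ≤ m) : ¬ HasPsdLift (convexHull ℝ (Set.range x)) 0 := by
  intro h
  have h0 : (0:ℕ) < m := by omega
  have h1 : (1:ℕ) < m := by omega
  have h2 : (2:ℕ) < m := by omega
  have hpos := hx (idx 2 h2) (idx 0 h0) (idx_ne h2 h0 (by norm_num))
    (by rw [idx_succ h1]; exact idx_ne h2 h1 (by norm_num))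
  have heq : x (idx 0 h0) = x (idx 1 h1) :=
    subsingleton_of_hasPsdLift_zero h (subset_convexHull ℝ _ ⟨_, rfl⟩) (subset_convexHull ℝ _ ⟨_, rfl⟩)
  rw [polygonSlack, Matrix.of_apply, idx_succ h1, ← heq, sub_self] at hpos
  simp [cross2] at hpos

/-- **GRT Theorem 4.7, lift form** (with FGPRT Thm. 3.3): a convex polygon is a linear image of an
affine slice of `S^3_+` iff it has at most four vertices. [cite: GouveiaRobinsonThomas2013, Thm. 4.7 (p11)] -/
theorem GouveiaRobinsonThomas2013_thm47_lift {x : Fin m → (Fin 2 → ℝ)} (hx : IsConvexPolygon x)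
    (hm : 3 ≤ m) : HasPsdLift (convexHull ℝ (Set.range x)) 3 ↔ m ≤ 4 :=
  (hx.hasPsdLift_iff hm (by norm_num)).trans (GouveiaRobinsonThomas2013_thm47 hx hm)

/-- **Convex `m`-gons with `m ≥ 5` have no psd lift of size `< 4`** (GRT Thm. 4.7 + FGPRT Thm. 3.3:
`rank_psd P ≥ 4`, i.e. `P ≠ π(S^k_+ ∩ L)` for `k ≤ 3`). [cite: GouveiaRobinsonThomas2013, Thm. 4.7 (p11)] -/
theorem IsConvexPolygon.four_le_of_hasPsdLift {x : Fin m → (Fin 2 → ℝ)} (hx : IsConvexPolygon x)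
    (hm : 5 ≤ m) {k : ℕ} (hk : HasPsdLift (convexHull ℝ (Set.range x)) k) : 4 ≤ k := by
  rcases Nat.eq_zero_or_pos k with rfl | hk1
  · exact absurd hk (hx.not_hasPsdLift_zero (by omega))
  · exact hx.four_le_of_hasPsdFactorization hm ((hx.hasPsdLift_iff (by omega) hk1).mp hk)

/-- **Every convex polygon needs psd lifts of size `≥ 3`** (GRT Prop. 3.2 / FGPRT Cor. 5.9 in lift form).
[cite: GouveiaRobinsonThomas2013, Prop. 3.2 (p07)] -/
theorem IsConvexPolygon.three_le_of_hasPsdLift {x : Fin m → (Fin 2 → ℝ)} (hx : IsConvexPolygon x)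
    (hm : 3 ≤ m) {k : ℕ} (hk : HasPsdLift (convexHull ℝ (Set.range x)) k) : 3 ≤ k := by
  rcases Nat.eq_zero_or_pos k with rfl | hk1
  · exact absurd hk (hx.not_hasPsdLift_zero hm)
  · exact hx.three_le_of_hasPsdFactorization hm ((hx.hasPsdLift_iff hm hk1).mp hk)

end PolygonGeometry

/-! ### GRT 2013 Example 2.7: positive diagonal matrices — psd rank `n`, all factors of rank one
(appended) -/

section GrtEx27

/-- **GRT Example 2.7** (p06, verbatim): "The psd rank of a `n × n` diagonal matrix with positive
diagonal entries is `n`. … Each factor in an `S^n_+`-factorization of such a diagonal matrix must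
have rank one. This follows by applying the second part of Proposition 2.6 to both the diagonal
matrix and its transpose." The first sentence is the tree's FGPRT Example 2.11
(`hasPsdFactorization_diagonal_iff`); PROVED here is the second, through the Proposition 2.6
mechanism `rank_colFactor_add_le` / `rank_rowFactor_add_le`: the rows vanishing in column `c` carry
the positive diagonal matrix on the other `n − 1` indices (psd rank `n − 1` by the fooling-set bound),
so `rank B_c + (n − 1) ≤ n`, and `B_c ≠ 0` because `⟨A_c, B_c⟩ = d_c > 0`.
[cite: GouveiaRobinsonThomas2013, Ex. 2.7 (p06), Prop. 2.6 (p05)] -/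
theorem GouveiaRobinsonThomas2013_ex27 {n : ℕ} {d : Fin n → ℝ} (hd : ∀ i, 0 < d i)
    (A B : Fin n → Matrix (Fin n) (Fin n) ℝ) (hA : ∀ i, (A i).PosSemidef)
    (hB : ∀ j, (B j).PosSemidef) (hM : ∀ i j, Matrix.diagonal d i j = (A i * B j).trace) :
    (HasPsdFactorization (Matrix.diagonal d) n ∧
      ∀ k, HasPsdFactorization (Matrix.diagonal d) k → n ≤ k) ∧
    (∀ i, (A i).rank = 1) ∧ ∀ j, (B j).rank = 1 := by
  classical
  have hd0 : ∀ i, 0 ≤ d i := fun i => (hd i).le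
  have hcard : (univ.filter fun i => d i ≠ 0).card = n := by
    rw [Finset.filter_true_of_mem fun i _ => (hd i).ne', Finset.card_univ, Fintype.card_fin]
  have hrank : HasPsdFactorization (Matrix.diagonal d) n ∧
      ∀ k, HasPsdFactorization (Matrix.diagonal d) k → n ≤ k := by
    refine ⟨(hasPsdFactorization_diagonal_iff hd0).mpr hcard.le, fun k hk => ?_⟩
    have := (hasPsdFactorization_diagonal_iff hd0).mp hk
    rwa [hcard] at this
  -- the fooling-set lower bound `n − 1` for the diagonal pattern off one index `c`
  have hlow : ∀ (c : Fin n) (P : Fin n → Prop), (∀ i, i ≠ c → P i) →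
      ∀ k (M' : {i // P i} → Fin n → ℝ), (∀ i j, M' i j = Matrix.diagonal d i.1 j) →
      HasPsdFactorization M' k → n - 1 ≤ k := by
    intro c P hP k M' hM' hk
    -- enumerate the indices `≠ c`
    let T : Finset (Fin n) := univ.erase c
    have hT : T.card = n - 1 := by rw [Finset.card_erase_of_mem (mem_univ c), card_univ, Fintype.card_fin]
    let e : Fin (n - 1) → Fin n := fun a => (T.equivFin.symm (Fin.cast hT.symm a) : T)
    have he : ∀ a, e a ≠ c := fun a => by
      have hmem : (e a) ∈ T := (T.equivFin.symm (Fin.cast hT.symm a)).2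
      exact (Finset.mem_erase.mp hmem).1
    have heinj : Function.Injective e := fun a b hab => by
      have := Subtype.ext hab
      simpa using this
    refine hk.card_le_of_triangular (fun a => ⟨e a, hP _ (he a)⟩) (fun a => e a) (fun a => ?_)
      (fun a b hab => ?_)
    · rw [hM', Matrix.diagonal_apply_eq]; exact (hd _).ne'
    · rw [hM', Matrix.diagonal_apply_ne _ (heinj.ne hab.ne)]
  -- nonzero factors: `⟨A_c, B_c⟩ = d_c ≠ 0`
  have hne : ∀ c, A c * B c ≠ 0 := fun c h0 => by
    have := hM c c
    rw [h0, Matrix.trace_zero, Matrix.diagonal_apply_eq] at this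
    exact (hd c).ne' this
  have hposA : ∀ c, 1 ≤ (A c).rank := fun c => by
    by_contra hlt
    have h0 : (A c).rank = 0 := by omega
    have hA0 : A c = 0 := by
      have := Matrix.rank_eq_finrank_span_row (A c)
      rw [h0] at this
      have hspan : Submodule.span ℝ (Set.range (A c).row) = ⊥ :=
        Submodule.finrank_eq_zero.mp this.symm
      ext s t
      have hs : (A c).row s ∈ Submodule.span ℝ (Set.range (A c).row) := Submodule.subset_span ⟨s, rfl⟩
      rw [hspan, Submodule.mem_bot] at hs
      exact congrFun hs t
    exact hne c (by rw [hA0, Matrix.zero_mul])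
  have hposB : ∀ c, 1 ≤ (B c).rank := fun c => by
    by_contra hlt
    have h0 : (B c).rank = 0 := by omega
    have hB0 : B c = 0 := by
      have := Matrix.rank_eq_finrank_span_row (B c)
      rw [h0] at this
      have hspan : Submodule.span ℝ (Set.range (B c).row) = ⊥ :=
        Submodule.finrank_eq_zero.mp this.symm
      ext s t
      have hs : (B c).row s ∈ Submodule.span ℝ (Set.range (B c).row) := Submodule.subset_span ⟨s, rfl⟩
      rw [hspan, Submodule.mem_bot] at hs
      exact congrFun hs t
    exact hne c (by rw [hB0, Matrix.mul_zero])
  have hn : ∀ c : Fin n, 1 ≤ n := fun c => Nat.succ_le_of_lt (Fin.pos c)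
  refine ⟨hrank, fun c => le_antisymm ?_ (hposA c), fun c => le_antisymm ?_ (hposB c)⟩
  · -- rows: transpose picture
    have h := rank_rowFactor_add_le (M := fun i j => Matrix.diagonal d i j) A B hA hB hM c
      (n := n - 1) fun k hk => hlow c (fun j => Matrix.diagonal d c j = 0)
        (fun j hj => Matrix.diagonal_apply_ne _ hj.symm) k (fun j i => Matrix.diagonal d j.1 i)
        (fun _ _ => rfl) ?_
    · have := hn c; omega
    · -- the transposed submatrix is again a diagonal pattern: `diag d i j = diag d j i`
      have e : (fun (j : {j // Matrix.diagonal d c j = 0}) i => Matrix.diagonal d j.1 i) =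
          fun j i => (fun i (j : {j // Matrix.diagonal d c j = 0}) => Matrix.diagonal d i j.1) i j := by
        funext j i
        by_cases hij : j.1 = i
        · simp [hij]
        · simp only [Matrix.diagonal_apply_ne _ hij, Matrix.diagonal_apply_ne _ (Ne.symm hij)]
      rw [e]; exact hk.transpose
  · have h := rank_colFactor_add_le (M := fun i j => Matrix.diagonal d i j) A B hA hB hM c
      (n := n - 1) fun k hk => hlow c (fun i => Matrix.diagonal d i c = 0)
        (fun i hi => Matrix.diagonal_apply_ne _ hi) k _ (fun _ _ => rfl) hk
    have := hn c; omega

end GrtEx27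

/-! ### GRT 2013 Remark 4.6: a psd-minimal prism whose slack matrix is not scalable to `0/1`
(appended) -/

section GrtRemark46

/-- The printed slack matrix of the prism with vertices `(0,0,0),(1,0,0),(0,1,0),(1,2,0),(0,0,1),
(1,0,1),(0,1,1),(1,2,1)`. [cite: GouveiaRobinsonThomas2013, Remark 4.6 (p11)] -/
def grtPrismSlack : Matrix (Fin 8) (Fin 6) ℝ :=
  !![0, 0, 2, 1, 0, 1; 1, 0, 0, 2, 0, 1; 0, 1, 2, 0, 0, 1; 1, 2, 0, 0, 0, 1;
     0, 0, 2, 1, 1, 0; 1, 0, 0, 2, 1, 0; 0, 1, 2, 0, 1, 0; 1, 2, 0, 0, 1, 0]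

/-- Its all-nonnegative Hadamard square root. [cite: GouveiaRobinsonThomas2013, Remark 4.6 (p11)] -/
def grtPrismSqrt : Matrix (Fin 8) (Fin 6) ℝ :=
  !![0, 0, Real.sqrt 2, 1, 0, 1; 1, 0, 0, Real.sqrt 2, 0, 1; 0, 1, Real.sqrt 2, 0, 0, 1;
     1, Real.sqrt 2, 0, 0, 0, 1; 0, 0, Real.sqrt 2, 1, 1, 0; 1, 0, 0, Real.sqrt 2, 1, 0;
     0, 1, Real.sqrt 2, 0, 1, 0; 1, Real.sqrt 2, 0, 0, 1, 0]

/-- `grtPrismSqrt` is the positive Hadamard square root of `grtPrismSlack`.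
[cite: GouveiaRobinsonThomas2013, Remark 4.6 (p11)] -/
theorem grtPrismSqrt_sq (i : Fin 8) (j : Fin 6) :
    grtPrismSqrt i j ^ 2 = grtPrismSlack i j ∧ 0 ≤ grtPrismSqrt i j := by
  fin_cases i <;> fin_cases j <;> norm_num [grtPrismSqrt, grtPrismSlack, Real.sqrt_nonneg]

/-- Columns `0,1,2,4` of the positive square root. [cite: GouveiaRobinsonThomas2013, Remark 4.6 (p11)] -/
def grtPrismSqrtU : Matrix (Fin 8) (Fin 4) ℝ :=
  !![0, 0, Real.sqrt 2, 0; 1, 0, 0, 0; 0, 1, Real.sqrt 2, 0; 1, Real.sqrt 2, 0, 0;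
     0, 0, Real.sqrt 2, 1; 1, 0, 0, 1; 0, 1, Real.sqrt 2, 1; 1, Real.sqrt 2, 0, 1]

/-- The reduced row echelon coefficients over `ℚ(√2)`. [cite: GouveiaRobinsonThomas2013, Remark 4.6 (p11)] -/
def grtPrismSqrtV : Matrix (Fin 4) (Fin 6) ℝ :=
  !![1, 0, 0, Real.sqrt 2, 0, 1; 0, 1, 0, -1, 0, 0; 0, 0, 1, Real.sqrt 2 / 2, 0, Real.sqrt 2 / 2;
     0, 0, 0, 0, 1, -1]

/-- The rank factorization of the positive square root through `ℝ⁴`.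
[cite: GouveiaRobinsonThomas2013, Remark 4.6 (p11)] -/
theorem grtPrismSqrt_eq_mul : grtPrismSqrt = grtPrismSqrtU * grtPrismSqrtV := by
  have hs : Real.sqrt 2 * Real.sqrt 2 = 2 := Real.mul_self_sqrt zero_le_two
  ext i j
  fin_cases i <;> fin_cases j <;>
    simp [grtPrismSqrt, grtPrismSqrtU, grtPrismSqrtV, Matrix.mul_apply, Fin.sum_univ_four] <;>
    grind

/-- **Remark 4.6**: "The positive square root of this matrix has rank four" (`≤ 4` through `ℝ⁴`,
`≥ 4` by the rational minor on rows `0,1,2,4` and columns `0,1,4,5`, of determinant `−1`).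
[cite: GouveiaRobinsonThomas2013, Remark 4.6 (p11)] -/
theorem rank_grtPrismSqrt : grtPrismSqrt.rank = 4 := by
  refine le_antisymm ?_ ?_
  · rw [grtPrismSqrt_eq_mul]
    exact (Matrix.rank_mul_le_left _ _).trans ((Matrix.rank_le_card_width grtPrismSqrtU).trans (by simp))
  · have hdet : (grtPrismSqrt.submatrix (![0, 1, 2, 4] : Fin 4 → Fin 8)
        (![0, 1, 4, 5] : Fin 4 → Fin 6)).det ≠ 0 := by
      have h : grtPrismSqrt.submatrix (![0, 1, 2, 4] : Fin 4 → Fin 8) (![0, 1, 4, 5] : Fin 4 → Fin 6) =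
          !![0, 0, 0, 1; 1, 0, 0, 1; 0, 1, 0, 1; 0, 0, 1, 0] := by
        ext i j
        fin_cases i <;> fin_cases j <;> rfl
      rw [h]
      have e1 : (Fin.succAbove (1 : Fin 4) (2 : Fin 3)) = 3 := by decide
      have e2 : (Fin.succAbove (2 : Fin 4) (2 : Fin 3)) = 3 := by decide
      have e3 : (Fin.succAbove (3 : Fin 4) (2 : Fin 3)) = 2 := by decide
      simp [Matrix.det_succ_row_zero, Fin.sum_univ_succ, e1, e2, e3]
    simpa using Literature.LinearAlgebra.Matrix.card_le_rank_of_det_submatrix_ne_zero grtPrismSqrt _ _ hdet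

/-- **Remark 4.6**: "so the polytope has minimal psd rank" — `rank_psd = 4` for the printed slack
matrix: `≤ 4` from the rank-four square root (Prop. 2.2 = FGPRT Cor. 5.3), `≥ 4` from the `4 × 4`
triangular pattern on rows `(0,4,1,2)` × columns `(2,4,0,1)` (fooling-set bound; GRT Prop. 3.2 gives the
same bound for any `3`-polytope). [cite: GouveiaRobinsonThomas2013, Remark 4.6 (p11)] -/
theorem grtPrismSlack_psdRank :
    HasPsdFactorization grtPrismSlack 4 ∧ ∀ k, HasPsdFactorization grtPrismSlack k → 4 ≤ k := by
  refine ⟨HasHadamardSqrtOfRankLE.hasPsdFactorization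
    ⟨grtPrismSqrt, fun i j => (grtPrismSqrt_sq i j).1, rank_grtPrismSqrt.le⟩, fun k hk => ?_⟩
  refine hk.card_le_of_triangular (![0, 4, 1, 2] : Fin 4 → Fin 8) (![2, 4, 0, 1] : Fin 4 → Fin 6)
    (fun a => ?_) (fun a b hab => ?_)
  · fin_cases a <;> simp [grtPrismSlack]
  · fin_cases a <;> fin_cases b <;> simp [grtPrismSlack] at hab ⊢

/-- **Remark 4.6**: "it is easy to see that we can never turn the submatrix from the first two rows
and the fourth and sixth columns into a `0/1`-matrix by any scaling" — no positive row/column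
scaling `r_i M_{ij} c_j` of the slack matrix is `0/1`-valued (rows `0,1`, columns `3,5` carry
`[[1,1],[2,1]]`). [cite: GouveiaRobinsonThomas2013, Remark 4.6 (p11)] -/
theorem grtPrismSlack_not_scalable :
    ¬ ∃ (r : Fin 8 → ℝ) (c : Fin 6 → ℝ), (∀ i, 0 < r i) ∧ (∀ j, 0 < c j) ∧
      ∀ i j, r i * grtPrismSlack i j * c j = 0 ∨ r i * grtPrismSlack i j * c j = 1 := by
  rintro ⟨r, c, hr, hc, h⟩
  have one : ∀ i j, grtPrismSlack i j ≠ 0 → r i * grtPrismSlack i j * c j = 1 := by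
    intro i j hij
    rcases h i j with h0 | h1
    · exfalso
      rcases mul_eq_zero.mp h0 with h0 | h0
      · rcases mul_eq_zero.mp h0 with h0 | h0
        · exact (hr i).ne' h0
        · exact hij h0
      · exact (hc j).ne' h0
    · exact h1
  have h03 := one 0 3 (by simp [grtPrismSlack])
  have h05 := one 0 5 (by simp [grtPrismSlack])
  have h13 := one 1 3 (by simp [grtPrismSlack])
  have h15 := one 1 5 (by simp [grtPrismSlack])
  simp [grtPrismSlack] at h03 h05 h13 h15
  -- `r₀c₃ = r₀c₅ = 1`, `2 r₁ c₃ = r₁ c₅ = 1`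
  have hc : c 3 = c 5 := by
    have := hr 0
    nlinarith [h03, h05]
  rw [hc] at h13
  nlinarith [h13, h15, hr 1, hc]

/-- **GRT 2013 Remark 4.6** (p11, verbatim): "Strictly weaker than being projectively equivalent to a
`2`-level polytope is the existence of a positive scaling of each row and column of `S_P` that turns
it into a `0/1`-matrix. This clearly implies minimal psd rank … So one could suppose this to be a
necessary and sufficient condition for having minimal psd rank. This turns out to be false. Consider
the prism with vertices `(0,0,0), (1,0,0), (0,1,0), (1,2,0), (0,0,1), (1,0,1), (0,1,1), (1,2,1)` which
has slack matrix [`grtPrismSlack`]. The positive square root of this matrix has rank four, so the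
polytope has minimal psd rank, but it is easy to see that we can never turn the submatrix from the
first two rows and the fourth and sixth columns into a `0/1`-matrix by any scaling." PROVED for the
printed matrix (the polytope itself is not re-derived from its vertices).
[cite: GouveiaRobinsonThomas2013, Remark 4.6 (p11)] -/
theorem GouveiaRobinsonThomas2013_remark46 :
    grtPrismSqrt.rank = 4 ∧
    (HasPsdFactorization grtPrismSlack 4 ∧ ∀ k, HasPsdFactorization grtPrismSlack k → 4 ≤ k) ∧
    ¬ ∃ (r : Fin 8 → ℝ) (c : Fin 6 → ℝ), (∀ i, 0 < r i) ∧ (∀ j, 0 < c j) ∧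
      ∀ i j, r i * grtPrismSlack i j * c j = 0 ∨ r i * grtPrismSlack i j * c j = 1 :=
  ⟨rank_grtPrismSqrt, grtPrismSlack_psdRank, grtPrismSlack_not_scalable⟩

end GrtRemark46

/-! ### GRT 2013 Proposition 4.4: the double simplex is not `2`-level beyond the plane (appended) -/

section GrtProp44

/-- The support of a slack matrix of the `n`-dimensional double simplex (bipyramid over an
`(n−1)`-simplex), rows = (first apex, the `n` base vertices, second apex), columns = the `2n` facets:
`[[0 ⋯ 0 | 1 ⋯ 1], [I_n | I_n], [1 ⋯ 1 | 0 ⋯ 0]]`. [cite: GouveiaRobinsonThomas2013, Prop. 4.4 (p10)] -/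
def doubleSimplexSupport (n : ℕ) : (Unit ⊕ (Fin n ⊕ Unit)) → (Fin n ⊕ Fin n) → ℝ
  | Sum.inl _, Sum.inl _ => 0
  | Sum.inl _, Sum.inr _ => 1
  | Sum.inr (Sum.inl i), Sum.inl k => if i = k then 1 else 0
  | Sum.inr (Sum.inl i), Sum.inr k => if i = k then 1 else 0
  | Sum.inr (Sum.inr _), Sum.inl _ => 1
  | Sum.inr (Sum.inr _), Sum.inr _ => 0

/-- **GRT Proposition 4.4** (p10, verbatim): "There is no `2`-level polytope that is combinatorially
equivalent to a double simplex except in the plane." Printed proof: "`P` is combinatorially equivalent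
to a `2`-level polytope if and only if there is a (`2`-level) polytope with slack matrix `M`" (the
`0/1` support matrix `doubleSimplexSupport n`); "Suppose `M` is the slack matrix of a `n`-dimensional
polytope. Then we should be able to factorize `M` as in the proof of Lemma 3.1 into the form
`M = [1 p_i] [β_j; −a_j]` … The left kernel of `V` is non-trivial since `V` is a `(n+2) × (n+1)`
matrix. Let `z'` be a non-zero element in the left kernel of `V`. Then … `z'M = 0`. This implies that
`z'` is a scalar multiple of `z = (1,−1,…,−1,1)` … But looking at the first column of `V`, which is all
ones, we see that `z` can be in the left kernel of `V` only if `n = 2`." Typed as that algebraic core: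
if `M_{ij} = β_j − a_jᵀ p_i` with points `p_i ∈ ℝⁿ` (`n ≥ 1`), then `n = 2`.
[cite: GouveiaRobinsonThomas2013, Prop. 4.4 (p10)] -/
theorem GouveiaRobinsonThomas2013_prop44 {n : ℕ} (hn : 1 ≤ n)
    (p : Unit ⊕ (Fin n ⊕ Unit) → (Fin n → ℝ)) (a : Fin n ⊕ Fin n → (Fin n → ℝ))
    (β : Fin n ⊕ Fin n → ℝ) (hM : ∀ i j, doubleSimplexSupport n i j = β j - a j ⬝ᵥ p i) : n = 2 := by
  classical
  -- the rows `(1, p_i)` of `V` are `n + 2` vectors in `ℝ^{n+1}`, hence dependent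
  let V : Unit ⊕ (Fin n ⊕ Unit) → (Fin (n + 1) → ℝ) := fun i => Fin.cons 1 (p i)
  have hdep : ¬ LinearIndependent ℝ V := by
    intro hli
    have := hli.fintype_card_le_finrank
    simp [Fintype.card_sum] at this
  obtain ⟨y, hy0, hyne⟩ : ∃ y : Unit ⊕ (Fin n ⊕ Unit) → ℝ, ∑ i, y i • V i = 0 ∧ ∃ i, y i ≠ 0 := by
    rw [Fintype.linearIndependent_iff] at hdep
    push Not at hdep
    exact hdep
  -- `y V = 0`: the all-ones column and the `p`-columns
  have hsum1 : ∑ i, y i = 0 := by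
    have := congrFun hy0 0
    simpa [V, Finset.sum_apply, Pi.smul_apply] using this
  have hsump : ∀ l : Fin n, ∑ i, y i * p i l = 0 := by
    intro l
    have := congrFun hy0 l.succ
    simpa [V, Finset.sum_apply, Pi.smul_apply] using this
  -- hence `y M = 0`
  have hyM : ∀ j, ∑ i, y i * doubleSimplexSupport n i j = 0 := by
    intro j
    simp_rw [hM, mul_sub, Finset.sum_sub_distrib, ← Finset.sum_mul, hsum1, zero_mul, zero_sub,
      neg_eq_zero, dotProduct, Finset.mul_sum]
    rw [Finset.sum_comm]
    refine Finset.sum_eq_zero fun l _ => ?_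
    have : ∑ i, y i * (a j l * p i l) = a j l * ∑ i, y i * p i l := by
      rw [Finset.mul_sum]; exact Finset.sum_congr rfl fun i _ => by ring
    rw [this, hsump, mul_zero]
  -- the left kernel of `M`: `y_{mid k} + y_bot = 0` and `y_top + y_{mid k} = 0`
  have hcol1 : ∀ k : Fin n, y (Sum.inr (Sum.inl k)) + y (Sum.inr (Sum.inr ())) = 0 := by
    intro k
    have := hyM (Sum.inl k)
    simpa [doubleSimplexSupport, Fintype.sum_sum_type, Finset.sum_ite_eq', eq_comm] using this
  have hcol2 : ∀ k : Fin n, y (Sum.inl ()) + y (Sum.inr (Sum.inl k)) = 0 := by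
    intro k
    have := hyM (Sum.inr k)
    simpa [doubleSimplexSupport, Fintype.sum_sum_type, Finset.sum_ite_eq', eq_comm] using this
  -- so `y = t · (1, −1, …, −1, 1)` and `Σ y = (2 − n) t`
  set t := y (Sum.inl ()) with ht
  have hmid : ∀ k : Fin n, y (Sum.inr (Sum.inl k)) = -t := fun k => by linarith [hcol2 k]
  obtain ⟨k0⟩ : Nonempty (Fin n) := ⟨⟨0, hn⟩⟩
  have hbot : y (Sum.inr (Sum.inr ())) = t := by linarith [hcol1 k0, hmid k0]
  have hsum : ∑ i, y i = (2 - n) * t := by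
    rw [Fintype.sum_sum_type, Fintype.sum_sum_type]
    simp only [Finset.univ_unique, Finset.sum_singleton, hmid, Finset.sum_const, Finset.card_univ,
      Fintype.card_fin]
    rw [show (default : Unit) = () from rfl, ← ht, hbot]
    ring
  have htne : t ≠ 0 := by
    intro h0
    obtain ⟨i, hi⟩ := hyne
    rcases i with _ | i | _
    · exact hi (by rw [show y (Sum.inl _) = t from rfl, h0])
    · exact hi (by rw [hmid, h0, neg_zero])
    · exact hi (by rw [show y (Sum.inr (Sum.inr _)) = y (Sum.inr (Sum.inr ())) from rfl, hbot, h0])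
  rw [hsum1] at hsum
  have h2 : (2 : ℝ) - n = 0 := by
    rcases mul_eq_zero.mp hsum.symm with h | h
    · exact h
    · exact absurd h htne
  have : (n : ℝ) = 2 := by linarith
  exact_mod_cast this

end GrtProp44

end Literature.Combinatorics.Optimization
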